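import Mathlib.MeasureTheory.Integral.IntegralEqImproper
import Literature.NumberTheory.Sieve.RosserSieveLemma17
import Literature.NumberTheory.Sieve.SieveFunctionsProofs
import HarnessLib

/-!
# Iwaniec's Lemma 18: the limits `T^±`, (7.7), `B = 0`, and `F = 1 + s^{−κ} T⁺`, `f = 1 − s^{−κ} T⁻`

Topic `Literature/NumberTheory/Sieve`; sixth file on Iwaniec, *Rosser's sieve*, Acta Arith. 36 (1980)
(after `RosserSieveMainTerm`, `RosserSieveSums`, `RosserSievePartialSummation`,
`RosserSieveRecurrences`, `RosserSieveMajorants`, `RosserSieveLemma17`).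

Lemma 18 (p. 195): "The series (7.1) and (7.2) converge and the limit functions `T^±(s)` satisfy
`0 < T^±(s) ≪ s^{κ+1} Q^±(s)`, (7.7)." The end of the paper (p. 202) then puts
`F(s) = 1 + s^{−κ} T⁺(s)`, `f(s) = 1 − s^{−κ} T⁻(s)`; that these ARE the `β`-sieve functions of
(1.8)–(1.9) rests on pp. 195–196: the functions `m = s^{−κ}(T⁺ + T⁻)`, `n = s^{−κ}(T⁺ − T⁻)` solve
(7.10)–(7.11), and pairing `m` with the adjoint `g` ((5.3)) gives (7.12), whence — "for `κ > 1/2` we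
have `β > 1` and `g(β − 1) = 0`. Thus `B = 0`". This file PROVES all of this for `κ > 1/2`, granted
the part of Lemma 13 that is used — `β > 1`, positivity of `q^±`, and super-exponential decay of
`q^±` ((6.3) with (6.5)) — packaged as `MajorantHyp κ β` and supplied by
`RosserMajorant.Iwaniec1980_lemma13` (`Iwaniec1980_lemma13.majorantHyp`); it so reduces the named
fact `Iwaniec1980_lemma18` of `RosserSieveSums.lean` to (that part of) Lemma 13 plus its
boundary case `κ = 1/2` (`Iwaniec1980_lemma18_half`, a named fact: there `β = 1` and the kernel
`(t − 1)^{−κ}` is singular at the sieving threshold, outside the present regularity lemmas).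

## Contents (namespace `Literature.BetaSieve`; `k(t) = κ t^{κ−1} (t − 1)^{−κ}` is `sieveKernel`)

* Limits: `contT_mono_right`, `contTLim par κ β s = sup_N T^{par}_N(s)`, `tendsto_contT_contTLim`,
  `contT_le_contTLim`, `contTLim_le`; monotone convergence for the recurrences (7.3)
  (`tendsto_setIntegral_sieveKernel_mul`, via `MeasureTheory.integral_tendsto_of_tendsto_of_monotone`
  with the dominating functions `c κ t^κ (t − 1)^{−κ−1} q^∓(t − 1)` of `RosserSieveMajorants`),
  hence (7.7): `contTLim_zero_eq_setIntegral` (`T⁻(s) = ∫_{(s,∞)} k(t) T⁺(t − 1) dt`, `s ≥ β`),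
  `contTLim_one_eq_setIntegral` (`s ≥ β + 1`), `contTLim_one_eq_of_le`
  (`T⁺(s) + s^κ = (β + 1)^κ + T⁺(β + 1)`, `0 < s ≤ β + 1`); continuity and the derivatives
  `(T^∓)' = −k T^±(· − 1)`.
* Candidates (p. 202): `candUpper = 1 + s^{−κ} T⁺`, `candLower` (`= 1 − s^{−κ} T⁻` for `s > β`,
  `= B̃ s^{−κ}` on `(0, β]`), `candConst = Ã = (β + 1)^κ + T⁺(β + 1)`, `candB = B̃ = β^κ − T⁻(β)`;
  (1.8)–(1.9): `candUpper_eq`, `hasDerivAt_candLower`, `hasDerivAt_candUpper`, continuity.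
* `B̃ = 0` (pp. 195–196): `candDiff = Q̃ = F̃ − f̃`; the inner product `⟨Q̃, g⟩` against Iwaniec's
  adjoint `g = SieveAdjoint.qFun κ` (`SieveFunctionsAdjoint.lean`) has derivative
  `−κ B̃ g(s)(s − 1)^{−κ}` on `(β, β + 1)` and `0` beyond (`hasDerivAt_sieveInnerProduct_inhom`,
  an inhomogeneous form of Greaves' Lemma 4.2.1), value `(Ã − B̃)(β − 1)^{1−κ} g(β − 1)` at `β`
  (`innerProduct_beta`, (7.12)) and limit `0` at infinity (`tendsto_innerProduct_zero`, from
  `Q̃ = O(e^{−3s})` and `g = O(s^N)`); with `g(β − 1) = 0` (the necessary condition, applied to the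
  greatest data) and `g(β) ≠ 0` (maximality of `β`: `β + 1` is not admissible) this forces `B̃ = 0`
  (`candB_eq_zero_of_greatest`).
* Identification: `isBetaSieveSolution_cand` (normalisation from `T^± ≤ c q^±` and the decay of
  `q^±`), `eqOn_cand` (`IsBetaSieveSolution.unique_of_beta_eq`), `lemma18_of_majorantHyp` (the
  statement of `Iwaniec1980_lemma18` for `κ > 1/2` under `MajorantHyp`),
  `Iwaniec1980_lemma18_of_lemma13`, and the chain down to
  `SieveSequence.Iwaniec1980_lower_of_lemma13` / `…upper_of_lemma13` (Theorem 1 for sieve sequences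
  from Lemma 13, `Iwaniec1980_lemma18_half` and Lemma 20, using
  `exists_isGreatestBetaSieveData_holds`).

## References

* H. Iwaniec, *Rosser's sieve*, Acta Arith. 36 (1980), 171–202: §5 (5.3); §6 (6.3), (6.5); §7,
  (7.7)–(7.13), Lemma 18, p. 196; §9, p. 202. [IwaniecActaArith1980]
* G. Greaves, *Sieves in Number Theory*, Springer (2001), §4.2.1 Lemma 1, §4.2.2 (2.10), (4.2.4.7).
  [Greaves2001]
-/

open Filter Set MeasureTheory intervalIntegral Asymptotics
open scoped Topology

noncomputable section

namespace Literature.NumberTheory.Sieve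

/-! ### The inner product against an adjoint, with an inhomogeneity -/

/-- Variant of `hasDerivAt_sieveInnerProduct` with an inhomogeneous term: if
`s R'(s) = −a R(s) − b R(s − 1) + E` and `(t r(t))' = a r + b r(t + 1)` at `s`, then
`⟨R, r⟩'(s) = r(s) E`. [folklore] -/
theorem hasDerivAt_sieveInnerProduct_inhom {a b : ℝ} {R r : ℝ → ℝ} {R' E s d : ℝ} (hd : d < s - 1)
    (hR : HasDerivAt R R' s) (hReq : s * R' = -a * R s - b * R (s - 1) + E)
    (hr : HasDerivAt (fun t => t * r t) (a * r s + b * r (s + 1)) s)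
    (hg : ContinuousOn (fun x => r (x + 1) * R x) (Ioi d)) :
    HasDerivAt (sieveInnerProduct b R r) (r s * E) s := by
  have hI := hasDerivAt_integral_sub_one hd hg
  have hP : HasDerivAt (fun t => t * r t * R t) ((a * r s + b * r (s + 1)) * R s + s * r s * R') s :=
    hr.mul hR
  have h := hP.sub (hI.const_mul b)
  have hfun : sieveInnerProduct b R r =
      fun t => t * r t * R t - b * ∫ x in (t - 1)..t, r (x + 1) * R x := by
    funext t; rfl
  rw [hfun]
  refine h.congr_deriv ?_
  have : s * r s * R' = r s * (s * R') := by ring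
  rw [this, hReq]
  ring

namespace BetaSieve

open BetaSieveForward (sieveKernel sieveKernel_nonneg continuousOn_sieveKernel exists_isBetaSieveSolution_of_qFun_eq_zero)
open RosserMajorant SieveAdjoint

variable {κ β : ℝ}

/-! ### Monotonicity in `R` and the limit functions -/

/-- `T^{par}_N(s)` is non-decreasing in `N` for `s ≥ 0` (the terms `S_n(s) ≥ 0`). [folklore] -/
theorem contT_mono_right (hκ : 0 ≤ κ) (hβ : 1 ≤ β) (par : ℕ) {s : ℝ} (hs : 0 ≤ s) :
    Monotone fun N => contT par κ β N s := by
  refine monotone_nat_of_le_succ fun N => ?_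
  rw [contT_succ]
  split_ifs
  · linarith [contS_nonneg hκ hβ (N + 1) hs]
  · linarith

/-- `T^{par}(s) = sup_N T^{par}_N(s)` (`= lim_R T^±_R(s)`, Iwaniec (7.2)–(7.7)), meaningful when the
partial sums are bounded (Lemma 17). [cite: IwaniecActaArith1980, §7 (7.7)] -/
def contTLim (par : ℕ) (κ β : ℝ) (s : ℝ) : ℝ := ⨆ N : ℕ, contT par κ β N s

/-- Under a uniform bound the partial sums converge to `T^{par}(s)`. [folklore] -/
theorem tendsto_contT_contTLim (hκ : 0 ≤ κ) (hβ : 1 ≤ β) (par : ℕ) {s M : ℝ} (hs : 0 ≤ s)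
    (hM : ∀ N, contT par κ β N s ≤ M) :
    Tendsto (fun N => contT par κ β N s) atTop (𝓝 (contTLim par κ β s)) :=
  tendsto_atTop_ciSup (contT_mono_right hκ hβ par hs) ⟨M, by rintro _ ⟨N, rfl⟩; exact hM N⟩

/-- `T^{par}_N(s) ≤ T^{par}(s)` under a uniform bound. [folklore] -/
theorem contT_le_contTLim (par : ℕ) {s M : ℝ} (hM : ∀ N, contT par κ β N s ≤ M) (N : ℕ) :
    contT par κ β N s ≤ contTLim par κ β s :=
  le_ciSup (f := fun N => contT par κ β N s) ⟨M, by rintro _ ⟨N, rfl⟩; exact hM N⟩ N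

/-- `T^{par}(s) ≤ M` for any uniform bound `M` of the partial sums. [folklore] -/
theorem contTLim_le (par : ℕ) {s M : ℝ} (hM : ∀ N, contT par κ β N s ≤ M) :
    contTLim par κ β s ≤ M :=
  ciSup_le hM

/-- `0 ≤ T^{par}(s)` for `s ≥ 0` (under a uniform bound). [folklore] -/
theorem contTLim_nonneg (hκ : 0 ≤ κ) (hβ : 1 ≤ β) (par : ℕ) {s M : ℝ} (hs : 0 ≤ s)
    (hM : ∀ N, contT par κ β N s ≤ M) : 0 ≤ contTLim par κ β s :=
  (contT_nonneg hκ hβ par 0 hs).trans (contT_le_contTLim par hM 0)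

/-! ### From the finite recurrences (7.3) to improper integrals -/

/-- A set integral over `(s, ∞)` of a function vanishing on `[U, ∞)` and continuous on `[s, U]` is
the interval integral over `[s, U]`. [folklore] -/
theorem setIntegral_Ioi_eq_intervalIntegral {f : ℝ → ℝ} {s U : ℝ} (hsU : s ≤ U)
    (hf : ContinuousOn f (Icc s U)) (hzero : ∀ t, U ≤ t → f t = 0) :
    ∫ t in Ioi s, f t = ∫ t in s..U, f t := by
  have h1 : IntegrableOn f (Ioc s U) volume :=
    (hf.integrableOn_Icc).mono_set Ioc_subset_Icc_self
  have h2 : IntegrableOn f (Ioi U) volume :=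
    (integrableOn_zero).congr_fun (fun t (ht : U < t) => (hzero t ht.le).symm) measurableSet_Ioi
  rw [← Ioc_union_Ioi_eq_Ioi hsU, setIntegral_union (Ioc_disjoint_Ioi_same) measurableSet_Ioi h1 h2,
    intervalIntegral.integral_of_le hsU,
    setIntegral_congr_fun measurableSet_Ioi (fun t (ht : U < t) => hzero t ht.le), integral_zero,
    add_zero]

/-- Integrability on `(s, ∞)` of a function continuous on `[s, U]` vanishing on `[U, ∞)`.
[folklore] -/
theorem integrableOn_Ioi_of_support {f : ℝ → ℝ} {s U : ℝ} (hsU : s ≤ U)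
    (hf : ContinuousOn f (Icc s U)) (hzero : ∀ t, U ≤ t → f t = 0) :
    IntegrableOn f (Ioi s) volume := by
  have h1 : IntegrableOn f (Ioc s U) volume :=
    (hf.integrableOn_Icc).mono_set Ioc_subset_Icc_self
  have h2 : IntegrableOn f (Ioi U) volume :=
    (integrableOn_zero).congr_fun (fun t (ht : U < t) => (hzero t ht.le).symm) measurableSet_Ioi
  rw [← Ioc_union_Ioi_eq_Ioi hsU]
  exact h1.union h2

/-- `T^{par}_N(u) = 0` for `u ≥ β + N` (all terms `S_n(u)`, `n ≤ N`, vanish). [folklore] -/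
theorem contT_eq_zero_of_le (par : ℕ) (κ : ℝ) {β : ℝ} {N : ℕ} {u : ℝ} (hu : β + N ≤ u) :
    contT par κ β N u = 0 := by
  unfold contT
  refine Finset.sum_eq_zero fun n hn => ?_
  rw [Finset.mem_filter, Finset.mem_range] at hn
  rcases Nat.eq_zero_or_pos n with h0 | hpos
  · subst h0; exact contS_zero κ β u
  · refine contS_eq_zero_of_le hpos ?_
    have : (n : ℝ) ≤ N := by exact_mod_cast (by omega : n ≤ N)
    linarith

/-- **Monotone convergence for the recurrences**: if `φ_N(u) ↑ Φ(u)` for `u ≥ s − 1` (`φ_N`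
continuous, vanishing for `u ≥ β + N`, e.g. `φ_N = T^{par}_N`), and `k(t) Φ(t − 1)` is dominated on
`(s, ∞)` by an integrable `g`, then `∫_{(s,∞)} k(t) φ_N(t − 1) dt → ∫_{(s,∞)} k(t) Φ(t − 1) dt`
(`s > 1`). [folklore] -/
theorem tendsto_setIntegral_sieveKernel_mul (hκ : 0 ≤ κ) {β s : ℝ} (hs : 1 < s)
    {φ : ℕ → ℝ → ℝ} {Φ : ℝ → ℝ} (hφc : ∀ N, Continuous (φ N))
    (hzero : ∀ (N : ℕ) (t : ℝ), β + N ≤ t - 1 → φ N (t - 1) = 0)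
    (hmono : ∀ t, s < t → Monotone fun N => φ N (t - 1))
    (hlim : ∀ t, s < t → Tendsto (fun N => φ N (t - 1)) atTop (𝓝 (Φ (t - 1))))
    {g : ℝ → ℝ} (hg : IntegrableOn g (Ioi s) volume)
    (hdom : ∀ t, s < t → |sieveKernel κ t * Φ (t - 1)| ≤ g t) :
    Tendsto (fun N => ∫ t in Ioi s, sieveKernel κ t * φ N (t - 1)) atTop
      (𝓝 (∫ t in Ioi s, sieveKernel κ t * Φ (t - 1))) := by
  -- integrability of the approximants (continuous, compactly supported in `[s, β + N + 1]`)
  have hcont : ∀ N, ContinuousOn (fun t => sieveKernel κ t * φ N (t - 1)) (Ici s) := fun N =>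
    ((continuousOn_sieveKernel κ).mono fun t (ht : s ≤ t) => show (1 : ℝ) < t by
      exact lt_of_lt_of_le hs ht).mul
      (((hφc N).comp (continuous_id.sub continuous_const)).continuousOn)
  have hint : ∀ N, Integrable (fun t => sieveKernel κ t * φ N (t - 1)) (volume.restrict (Ioi s)) := by
    intro N
    set U := max s (β + N + 1) with hU
    have h := integrableOn_Ioi_of_support (f := fun t => sieveKernel κ t * φ N (t - 1))
      (le_max_left s (β + N + 1)) ((hcont N).mono Icc_subset_Ici_self) fun t ht => by
        show sieveKernel κ t * φ N (t - 1) = 0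
        rw [hzero N t (by linarith [le_max_right s (β + (N : ℝ) + 1)]), mul_zero]
    exact h
  -- measurability and integrability of the limit
  have hmeas : AEStronglyMeasurable (fun t => sieveKernel κ t * Φ (t - 1))
      (volume.restrict (Ioi s)) := by
    refine aestronglyMeasurable_of_tendsto_ae atTop (fun N => (hint N).aestronglyMeasurable) ?_
    refine (ae_restrict_mem measurableSet_Ioi).mono fun t (ht : s < t) => ?_
    exact (hlim t ht).const_mul _
  have hF : Integrable (fun t => sieveKernel κ t * Φ (t - 1)) (volume.restrict (Ioi s)) := by
    refine Integrable.mono' hg hmeas ?_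
    refine (ae_restrict_mem measurableSet_Ioi).mono fun t (ht : s < t) => ?_
    rw [Real.norm_eq_abs]
    exact hdom t ht
  refine integral_tendsto_of_tendsto_of_monotone hint hF ?_ ?_
  · refine (ae_restrict_mem measurableSet_Ioi).mono fun t (ht : s < t) => ?_
    intro N M hNM
    exact mul_le_mul_of_nonneg_left (hmono t ht hNM) (sieveKernel_nonneg hκ (by linarith : (1:ℝ) ≤ t))
  · refine (ae_restrict_mem measurableSet_Ioi).mono fun t (ht : s < t) => ?_
    exact (hlim t ht).const_mul _

/-! ### The integral equations (7.7) for the limits -/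

section Limits

variable (hκ : 0 < κ) (hβ : 1 < β) {c : ℝ}
  (hpos : ∀ u : ℝ, 0 < u → 0 < qUpper κ β u ∧ 0 < qLower κ β u)
  (hbdM : ∀ (N : ℕ) (u : ℝ), β ≤ u → contT 0 κ β N u ≤ c * qLower κ β u)
  (hbdP : ∀ (N : ℕ) (u : ℝ), β - 1 ≤ u → contT 1 κ β N u ≤ c * qUpper κ β u)
include hκ hβ hpos hbdM hbdP

omit hκ hbdM in
/-- The constant of a majorant bound is nonnegative. [folklore] -/
theorem majorant_const_nonneg : 0 ≤ c := by
  have h := hbdP 0 β (by linarith)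
  rw [contT_zero_right] at h
  have hq := (hpos β (by linarith)).1
  nlinarith

omit hbdM in
/-- The dominating function `c κ t^κ (t − 1)^{−κ−1} q⁺(t − 1)` is integrable on `(s, ∞)`, `s ≥ β`,
with integral at most `c q⁻(s)` ((6.2) integrated: `qLower_sub_eq_integral`). [folklore] -/
theorem integrableOn_majorant_qUpper {s : ℝ} (hs : β ≤ s) :
    IntegrableOn (fun t => c * (κ * t ^ κ * (t - 1) ^ (-κ - 1) * qUpper κ β (t - 1))) (Ioi s)
      volume := by
  have hc := majorant_const_nonneg hβ hpos hbdP
  have hs1 : 1 < s := by linarith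
  have hcont : ∀ u, s ≤ u → ContinuousOn
      (fun t => c * (κ * t ^ κ * (t - 1) ^ (-κ - 1) * qUpper κ β (t - 1))) (Icc s u) := fun u _ =>
    continuousOn_const.mul ((continuousOn_integrand_qUpper (κ := κ) hβ).mono
      fun t ht => show (1 : ℝ) < t from lt_of_lt_of_le hs1 ht.1)
  refine integrableOn_Ioi_of_intervalIntegral_norm_bounded (c * qLower κ β s) s
    (b := fun n : ℕ => s + n) (l := atTop) (fun n => ?_) ?_ ?_
  · exact ((hcont (s + n) (by simp)).integrableOn_Icc).mono_set Ioc_subset_Icc_self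
  · exact tendsto_atTop_add_const_left _ _ tendsto_natCast_atTop_atTop
  · refine Eventually.of_forall fun n => ?_
    have hsn : s ≤ s + n := by simp
    have hnn : ∀ t ∈ Icc s (s + n),
        0 ≤ c * (κ * t ^ κ * (t - 1) ^ (-κ - 1) * qUpper κ β (t - 1)) := by
      intro t ht
      have h1 : 0 ≤ t ^ κ := Real.rpow_nonneg (by linarith [ht.1]) κ
      have h2 : 0 ≤ (t - 1) ^ (-κ - 1) := Real.rpow_nonneg (by linarith [ht.1]) _
      have h3 := (hpos (t - 1) (by linarith [ht.1])).1
      positivity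
    calc ∫ t in s..(s + n), ‖c * (κ * t ^ κ * (t - 1) ^ (-κ - 1) * qUpper κ β (t - 1))‖
        = ∫ t in s..(s + n), c * (κ * t ^ κ * (t - 1) ^ (-κ - 1) * qUpper κ β (t - 1)) := by
          refine intervalIntegral.integral_congr fun t ht => ?_
          rw [uIcc_of_le hsn] at ht
          exact Real.norm_of_nonneg (hnn t ht)
      _ = c * (qLower κ β s - qLower κ β (s + n)) := by
          rw [intervalIntegral.integral_const_mul, qLower_sub_eq_integral hβ hs hsn]
      _ ≤ c * qLower κ β s := by
          have := (hpos (s + n) (by linarith)).2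
          nlinarith

/-- **(7.7) for `T⁻`**: `T⁻(s) = ∫_s^∞ k(t) T⁺(t − 1) dt` (`= κ ∫_s^∞ (1 − 1/t)^{−κ} T⁺(t − 1) dt/t`)
for `s ≥ β`, for the limits `T^± = contTLim` of the partial sums, under a majorant bound
`T^±_N ≤ c q^±` (Lemma 17) — from (7.3) by monotone convergence.
[cite: IwaniecActaArith1980, Lemma 18 (7.7)] -/
theorem contTLim_zero_eq_setIntegral {s : ℝ} (hs : β ≤ s) :
    contTLim 0 κ β s = ∫ t in Ioi s, sieveKernel κ t * contTLim 1 κ β (t - 1) := by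
  have hc := majorant_const_nonneg hβ hpos hbdP
  have hs1 : 1 < s := by linarith
  -- the approximants are the finite recurrences (7.3)
  have happrox : ∀ N : ℕ,
      ∫ t in Ioi s, sieveKernel κ t * contT 1 κ β N (t - 1) = contT 0 κ β (N + 1) s := by
    intro N
    rw [contT_zero_succ_eq_integral hκ.le hβ N hs le_rfl]
    refine setIntegral_Ioi_eq_intervalIntegral (le_max_left _ _) ?_ fun t ht => ?_
    · exact (((continuousOn_sieveKernel κ).mono fun t ht => show (1 : ℝ) < t from
        lt_of_lt_of_le hs1 ht.1).mul
        (((continuous_contT hκ.le hβ 1 N).comp (continuous_id.sub continuous_const)).continuousOn))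
    · rw [contT_eq_zero_of_le 1 κ (by linarith [le_max_right s (β + (N : ℝ) + 1)]), mul_zero]
  -- monotone convergence
  have hmct := tendsto_setIntegral_sieveKernel_mul hκ.le (β := β) hs1
    (φ := fun N => contT 1 κ β N) (Φ := contTLim 1 κ β)
    (fun N => continuous_contT hκ.le hβ 1 N) (fun N t ht => contT_eq_zero_of_le 1 κ ht)
    (fun t ht => contT_mono_right hκ.le hβ.le 1 (by linarith))
    (fun t ht => tendsto_contT_contTLim hκ.le hβ.le 1 (by linarith)
      (fun N => hbdP N (t - 1) (by linarith)))
    (integrableOn_majorant_qUpper hκ hβ hpos hbdP hs) (fun t ht => ?_)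
  · simp_rw [happrox] at hmct
    have hlim2 : Tendsto (fun N => contT 0 κ β (N + 1) s) atTop (𝓝 (contTLim 0 κ β s)) :=
      (tendsto_contT_contTLim hκ.le hβ.le 0 (by linarith) (fun N => hbdM N s hs)).comp
        (tendsto_add_atTop_nat 1)
    exact tendsto_nhds_unique hlim2 hmct
  · -- domination: `|k(t) T⁺(t-1)| ≤ c κ t^κ (t-1)^{-κ-1} q⁺(t-1)`
    have ht1 : 1 < t := by linarith
    have hbd : ∀ N, contT 1 κ β N (t - 1) ≤ c * qUpper κ β (t - 1) := fun N => hbdP N _ (by linarith)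
    have hΦ0 : 0 ≤ contTLim 1 κ β (t - 1) := contTLim_nonneg hκ.le hβ.le 1 (by linarith) hbd
    have hΦle : contTLim 1 κ β (t - 1) ≤ c * qUpper κ β (t - 1) := contTLim_le 1 hbd
    have hk0 : 0 ≤ sieveKernel κ t := sieveKernel_nonneg hκ.le ht1.le
    rw [abs_of_nonneg (mul_nonneg hk0 hΦ0)]
    calc sieveKernel κ t * contTLim 1 κ β (t - 1) ≤ sieveKernel κ t * (c * qUpper κ β (t - 1)) :=
          mul_le_mul_of_nonneg_left hΦle hk0
      _ ≤ κ * t ^ κ * (t - 1) ^ (-κ - 1) * (c * qUpper κ β (t - 1)) :=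
          sieveKernel_mul_le hκ.le ht1 (mul_nonneg hc (hpos _ (by linarith)).1.le)
      _ = c * (κ * t ^ κ * (t - 1) ^ (-κ - 1) * qUpper κ β (t - 1)) := by ring

end Limits

section Limits2

variable (hκ : 0 < κ) (hβ : 1 < β) {c : ℝ}
  (hpos : ∀ u : ℝ, 0 < u → 0 < qUpper κ β u ∧ 0 < qLower κ β u)
  (hbdM : ∀ (N : ℕ) (u : ℝ), β ≤ u → contT 0 κ β N u ≤ c * qLower κ β u)
  (hbdP : ∀ (N : ℕ) (u : ℝ), β - 1 ≤ u → contT 1 κ β N u ≤ c * qUpper κ β u)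
include hκ hβ hpos hbdM hbdP

omit hbdM in
/-- The dominating function `c κ t^κ (t − 1)^{−κ−1} q⁻(t − 1)` is integrable on `(s, ∞)`, `s ≥ β + 1`,
with integral at most `c q⁺(s)` (`qUpper_sub_eq_integral`). [folklore] -/
theorem integrableOn_majorant_qLower {s : ℝ} (hs : β + 1 ≤ s) :
    IntegrableOn (fun t => c * (κ * t ^ κ * (t - 1) ^ (-κ - 1) * qLower κ β (t - 1))) (Ioi s)
      volume := by
  have hc := majorant_const_nonneg hβ hpos hbdP
  have hs1 : 1 < s := by linarith
  have hcont : ∀ u, s ≤ u → ContinuousOn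
      (fun t => c * (κ * t ^ κ * (t - 1) ^ (-κ - 1) * qLower κ β (t - 1))) (Icc s u) := fun u _ =>
    continuousOn_const.mul ((continuousOn_integrand_qLower (κ := κ) hβ).mono
      fun t ht => show (1 : ℝ) < t from lt_of_lt_of_le hs1 ht.1)
  refine integrableOn_Ioi_of_intervalIntegral_norm_bounded (c * qUpper κ β s) s
    (b := fun n : ℕ => s + n) (l := atTop) (fun n => ?_) ?_ ?_
  · exact ((hcont (s + n) (by simp)).integrableOn_Icc).mono_set Ioc_subset_Icc_self
  · exact tendsto_atTop_add_const_left _ _ tendsto_natCast_atTop_atTop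
  · refine Eventually.of_forall fun n => ?_
    have hsn : s ≤ s + n := by simp
    have hnn : ∀ t ∈ Icc s (s + n),
        0 ≤ c * (κ * t ^ κ * (t - 1) ^ (-κ - 1) * qLower κ β (t - 1)) := by
      intro t ht
      have h1 : 0 ≤ t ^ κ := Real.rpow_nonneg (by linarith [ht.1]) κ
      have h2 : 0 ≤ (t - 1) ^ (-κ - 1) := Real.rpow_nonneg (by linarith [ht.1]) _
      have h3 := (hpos (t - 1) (by linarith [ht.1])).2
      positivity
    calc ∫ t in s..(s + n), ‖c * (κ * t ^ κ * (t - 1) ^ (-κ - 1) * qLower κ β (t - 1))‖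
        = ∫ t in s..(s + n), c * (κ * t ^ κ * (t - 1) ^ (-κ - 1) * qLower κ β (t - 1)) := by
          refine intervalIntegral.integral_congr fun t ht => ?_
          rw [uIcc_of_le hsn] at ht
          exact Real.norm_of_nonneg (hnn t ht)
      _ = c * (qUpper κ β s - qUpper κ β (s + n)) := by
          rw [intervalIntegral.integral_const_mul, qUpper_sub_eq_integral hβ hs hsn]
      _ ≤ c * qUpper κ β s := by
          have := (hpos (s + n) (by linarith)).1
          nlinarith

/-- **(7.7) for `T⁺`**: `T⁺(s) = ∫_s^∞ k(t) T⁻(t − 1) dt` for `s ≥ β + 1` (limits under a majorant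
bound). [cite: IwaniecActaArith1980, Lemma 18 (7.7)] -/
theorem contTLim_one_eq_setIntegral {s : ℝ} (hs : β + 1 ≤ s) :
    contTLim 1 κ β s = ∫ t in Ioi s, sieveKernel κ t * contTLim 0 κ β (t - 1) := by
  have hc := majorant_const_nonneg hβ hpos hbdP
  have hs1 : 1 < s := by linarith
  have happrox : ∀ N : ℕ,
      ∫ t in Ioi s, sieveKernel κ t * contT 0 κ β N (t - 1) = contT 1 κ β (N + 1) s := by
    intro N
    rw [contT_one_succ_eq_integral hκ.le hβ N hs le_rfl]
    refine setIntegral_Ioi_eq_intervalIntegral (le_max_left _ _) ?_ fun t ht => ?_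
    · exact (((continuousOn_sieveKernel κ).mono fun t ht => show (1 : ℝ) < t from
        lt_of_lt_of_le hs1 ht.1).mul
        (((continuous_contT hκ.le hβ 0 N).comp (continuous_id.sub continuous_const)).continuousOn))
    · rw [contT_eq_zero_of_le 0 κ (by linarith [le_max_right s (β + (N : ℝ) + 1)]), mul_zero]
  have hmct := tendsto_setIntegral_sieveKernel_mul hκ.le (β := β) hs1
    (φ := fun N => contT 0 κ β N) (Φ := contTLim 0 κ β)
    (fun N => continuous_contT hκ.le hβ 0 N) (fun N t ht => contT_eq_zero_of_le 0 κ ht)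
    (fun t ht => contT_mono_right hκ.le hβ.le 0 (by linarith))
    (fun t ht => tendsto_contT_contTLim hκ.le hβ.le 0 (by linarith)
      (fun N => hbdM N (t - 1) (by linarith)))
    (integrableOn_majorant_qLower hκ hβ hpos hbdP hs) (fun t ht => ?_)
  · simp_rw [happrox] at hmct
    have hlim2 : Tendsto (fun N => contT 1 κ β (N + 1) s) atTop (𝓝 (contTLim 1 κ β s)) :=
      (tendsto_contT_contTLim hκ.le hβ.le 1 (by linarith) (fun N => hbdP N s (by linarith))).comp
        (tendsto_add_atTop_nat 1)
    exact tendsto_nhds_unique hlim2 hmct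
  · have ht1 : 1 < t := by linarith
    have hbd : ∀ N, contT 0 κ β N (t - 1) ≤ c * qLower κ β (t - 1) := fun N => hbdM N _ (by linarith)
    have hΦ0 : 0 ≤ contTLim 0 κ β (t - 1) := contTLim_nonneg hκ.le hβ.le 0 (by linarith) hbd
    have hΦle : contTLim 0 κ β (t - 1) ≤ c * qLower κ β (t - 1) := contTLim_le 0 hbd
    have hk0 : 0 ≤ sieveKernel κ t := sieveKernel_nonneg hκ.le ht1.le
    rw [abs_of_nonneg (mul_nonneg hk0 hΦ0)]
    calc sieveKernel κ t * contTLim 0 κ β (t - 1) ≤ sieveKernel κ t * (c * qLower κ β (t - 1)) :=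
          mul_le_mul_of_nonneg_left hΦle hk0
      _ ≤ κ * t ^ κ * (t - 1) ^ (-κ - 1) * (c * qLower κ β (t - 1)) :=
          sieveKernel_mul_le hκ.le ht1 (mul_nonneg hc (hpos _ (by linarith)).2.le)
      _ = c * (κ * t ^ κ * (t - 1) ^ (-κ - 1) * qLower κ β (t - 1)) := by ring

omit hpos hbdM in
/-- **(7.7), the `+` boundary relation**: `T⁺(s) + s^κ = (β + 1)^κ + T⁺(β + 1)` for
`0 < s ≤ β + 1` (the limit of (7.3), third line). [cite: IwaniecActaArith1980, Lemma 18 (7.7)] -/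
theorem contTLim_one_eq_of_le {s : ℝ} (hs0 : 0 < s) (hs : s ≤ β + 1) :
    contTLim 1 κ β s = (β + 1) ^ κ - s ^ κ + contTLim 1 κ β (β + 1) := by
  have hbdb : ∀ N, contT 1 κ β N (β + 1) ≤ c * qUpper κ β (β + 1) := fun N => hbdP N _ (by linarith)
  have hbds : ∀ N, contT 1 κ β N s ≤ (β + 1) ^ κ + c * qUpper κ β (β + 1) := by
    intro N
    rcases Nat.eq_zero_or_pos N with h0 | hN
    · subst h0
      rw [contT_zero_right]
      have := hbdb 0; rw [contT_zero_right] at this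
      have : 0 ≤ (β + 1) ^ κ := Real.rpow_nonneg (by linarith) κ
      linarith
    · rw [contT_one_eq_of_le hN hs]
      have := hbdb N
      have : 0 ≤ s ^ κ := Real.rpow_nonneg hs0.le κ
      linarith
  have h1 := tendsto_contT_contTLim hκ.le hβ.le 1 hs0.le hbds
  have h2 : Tendsto (fun N => (β + 1) ^ κ - s ^ κ + contT 1 κ β N (β + 1)) atTop
      (𝓝 ((β + 1) ^ κ - s ^ κ + contTLim 1 κ β (β + 1))) :=
    (tendsto_contT_contTLim hκ.le hβ.le 1 (by linarith) hbdb).const_add _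
  have heq : (fun N => contT 1 κ β N s) =ᶠ[atTop]
      fun N => (β + 1) ^ κ - s ^ κ + contT 1 κ β N (β + 1) := by
    filter_upwards [eventually_ge_atTop 1] with N hN
    exact contT_one_eq_of_le hN hs
  exact tendsto_nhds_unique (h1.congr' heq) h2

omit hκ hβ hpos hbdP in
/-- The limits inherit the majorant bounds: `T⁻(s) ≤ c q⁻(s)` for `s ≥ β`. [folklore] -/
theorem contTLim_zero_le {s : ℝ} (hs : β ≤ s) : contTLim 0 κ β s ≤ c * qLower κ β s :=
  contTLim_le 0 fun N => hbdM N s hs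

omit hκ hβ hpos hbdM in
/-- `T⁺(s) ≤ c q⁺(s)` for `s ≥ β − 1`. [folklore] -/
theorem contTLim_one_le {s : ℝ} (hs : β - 1 ≤ s) : contTLim 1 κ β s ≤ c * qUpper κ β s :=
  contTLim_le 1 fun N => hbdP N s hs

end Limits2

/-! ### Integrability of the limit integrands, continuity and differentiability of `T^±` -/

section Regularity

variable (hκ : 0 < κ) (hβ : 1 < β) {c : ℝ}
  (hpos : ∀ u : ℝ, 0 < u → 0 < qUpper κ β u ∧ 0 < qLower κ β u)
  (hbdM : ∀ (N : ℕ) (u : ℝ), β ≤ u → contT 0 κ β N u ≤ c * qLower κ β u)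
  (hbdP : ∀ (N : ℕ) (u : ℝ), β - 1 ≤ u → contT 1 κ β N u ≤ c * qUpper κ β u)
include hκ hβ hpos hbdM hbdP

omit hbdM in
/-- The integrand `k(t) T⁺(t − 1)` of `T⁻` is integrable on `(s, ∞)` for `s ≥ β` (dominated by
`c κ t^κ (t − 1)^{−κ−1} q⁺(t − 1)`; measurable as a pointwise limit). [folklore] -/
theorem integrableOn_sieveKernel_mul_contTLim_one {s : ℝ} (hs : β ≤ s) :
    IntegrableOn (fun t => sieveKernel κ t * contTLim 1 κ β (t - 1)) (Ioi s) volume := by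
  have hc := majorant_const_nonneg hβ hpos hbdP
  have hs1 : 1 < s := by linarith
  -- measurability: pointwise limit of the continuous approximants
  have hmeas : AEStronglyMeasurable (fun t => sieveKernel κ t * contTLim 1 κ β (t - 1))
      (volume.restrict (Ioi s)) := by
    refine aestronglyMeasurable_of_tendsto_ae atTop
      (f := fun N t => sieveKernel κ t * contT 1 κ β N (t - 1)) (fun N => ?_) ?_
    · exact ((((continuousOn_sieveKernel κ).mono fun t (ht : s < t) => show (1 : ℝ) < t from
        hs1.trans ht).mul (((continuous_contT hκ.le hβ 1 N).comp
          (continuous_id.sub continuous_const)).continuousOn)).aestronglyMeasurable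
        measurableSet_Ioi)
    · refine (ae_restrict_mem measurableSet_Ioi).mono fun t (ht : s < t) => ?_
      exact (tendsto_contT_contTLim hκ.le hβ.le 1 (by linarith)
        (fun N => hbdP N (t - 1) (by linarith))).const_mul _
  refine Integrable.mono' (integrableOn_majorant_qUpper hκ hβ hpos hbdP hs) hmeas ?_
  refine (ae_restrict_mem measurableSet_Ioi).mono fun t (ht : s < t) => ?_
  have ht1 : 1 < t := by linarith
  have hbd : ∀ N, contT 1 κ β N (t - 1) ≤ c * qUpper κ β (t - 1) := fun N => hbdP N _ (by linarith)
  have hΦ0 : 0 ≤ contTLim 1 κ β (t - 1) := contTLim_nonneg hκ.le hβ.le 1 (by linarith) hbd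
  have hk0 : 0 ≤ sieveKernel κ t := sieveKernel_nonneg hκ.le ht1.le
  rw [Real.norm_eq_abs, abs_of_nonneg (mul_nonneg hk0 hΦ0)]
  calc sieveKernel κ t * contTLim 1 κ β (t - 1) ≤ sieveKernel κ t * (c * qUpper κ β (t - 1)) :=
        mul_le_mul_of_nonneg_left (contTLim_le 1 hbd) hk0
    _ ≤ κ * t ^ κ * (t - 1) ^ (-κ - 1) * (c * qUpper κ β (t - 1)) :=
        sieveKernel_mul_le hκ.le ht1 (mul_nonneg hc (hpos _ (by linarith)).1.le)
    _ = c * (κ * t ^ κ * (t - 1) ^ (-κ - 1) * qUpper κ β (t - 1)) := by ring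

/-- The integrand `k(t) T⁻(t − 1)` of `T⁺` is integrable on `(s, ∞)` for `s ≥ β + 1`. [folklore] -/
theorem integrableOn_sieveKernel_mul_contTLim_zero {s : ℝ} (hs : β + 1 ≤ s) :
    IntegrableOn (fun t => sieveKernel κ t * contTLim 0 κ β (t - 1)) (Ioi s) volume := by
  have hc := majorant_const_nonneg hβ hpos hbdP
  have hs1 : 1 < s := by linarith
  have hmeas : AEStronglyMeasurable (fun t => sieveKernel κ t * contTLim 0 κ β (t - 1))
      (volume.restrict (Ioi s)) := by
    refine aestronglyMeasurable_of_tendsto_ae atTop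
      (f := fun N t => sieveKernel κ t * contT 0 κ β N (t - 1)) (fun N => ?_) ?_
    · exact ((((continuousOn_sieveKernel κ).mono fun t (ht : s < t) => show (1 : ℝ) < t from
        hs1.trans ht).mul (((continuous_contT hκ.le hβ 0 N).comp
          (continuous_id.sub continuous_const)).continuousOn)).aestronglyMeasurable
        measurableSet_Ioi)
    · refine (ae_restrict_mem measurableSet_Ioi).mono fun t (ht : s < t) => ?_
      exact (tendsto_contT_contTLim hκ.le hβ.le 0 (by linarith)
        (fun N => hbdM N (t - 1) (by linarith))).const_mul _
  refine Integrable.mono' (integrableOn_majorant_qLower hκ hβ hpos hbdP hs) hmeas ?_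
  refine (ae_restrict_mem measurableSet_Ioi).mono fun t (ht : s < t) => ?_
  have ht1 : 1 < t := by linarith
  have hbd : ∀ N, contT 0 κ β N (t - 1) ≤ c * qLower κ β (t - 1) := fun N => hbdM N _ (by linarith)
  have hΦ0 : 0 ≤ contTLim 0 κ β (t - 1) := contTLim_nonneg hκ.le hβ.le 0 (by linarith) hbd
  have hk0 : 0 ≤ sieveKernel κ t := sieveKernel_nonneg hκ.le ht1.le
  rw [Real.norm_eq_abs, abs_of_nonneg (mul_nonneg hk0 hΦ0)]
  calc sieveKernel κ t * contTLim 0 κ β (t - 1) ≤ sieveKernel κ t * (c * qLower κ β (t - 1)) :=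
        mul_le_mul_of_nonneg_left (contTLim_le 0 hbd) hk0
    _ ≤ κ * t ^ κ * (t - 1) ^ (-κ - 1) * (c * qLower κ β (t - 1)) :=
        sieveKernel_mul_le hκ.le ht1 (mul_nonneg hc (hpos _ (by linarith)).2.le)
    _ = c * (κ * t ^ κ * (t - 1) ^ (-κ - 1) * qLower κ β (t - 1)) := by ring

/-- `T⁻` as a primitive: `T⁻(s) = T⁻(β) − ∫_β^s k(t) T⁺(t − 1) dt` for `s ≥ β`. [folklore] -/
theorem contTLim_zero_eq_sub_integral {s : ℝ} (hs : β ≤ s) :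
    contTLim 0 κ β s =
      contTLim 0 κ β β - ∫ t in β..s, sieveKernel κ t * contTLim 1 κ β (t - 1) := by
  rw [contTLim_zero_eq_setIntegral hκ hβ hpos hbdM hbdP hs,
    contTLim_zero_eq_setIntegral hκ hβ hpos hbdM hbdP le_rfl,
    ← intervalIntegral.integral_Ioi_sub_Ioi
      (integrableOn_sieveKernel_mul_contTLim_one hκ hβ hpos hbdP le_rfl) hs]
  ring

/-- `T⁺` as a primitive: `T⁺(s) = T⁺(β + 1) − ∫_{β+1}^s k(t) T⁻(t − 1) dt` for `s ≥ β + 1`.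
[folklore] -/
theorem contTLim_one_eq_sub_integral {s : ℝ} (hs : β + 1 ≤ s) :
    contTLim 1 κ β s =
      contTLim 1 κ β (β + 1) - ∫ t in (β + 1)..s, sieveKernel κ t * contTLim 0 κ β (t - 1) := by
  rw [contTLim_one_eq_setIntegral hκ hβ hpos hbdM hbdP hs,
    contTLim_one_eq_setIntegral hκ hβ hpos hbdM hbdP le_rfl,
    ← intervalIntegral.integral_Ioi_sub_Ioi
      (integrableOn_sieveKernel_mul_contTLim_zero hκ hβ hpos hbdM hbdP le_rfl) hs]
  ring

omit hκ hβ hpos hbdM hbdP in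
/-- The integrand `k(t) Φ(t − 1)` is continuous on `(1, ∞)` once `Φ` is continuous on `(0, ∞)`.
[folklore] -/
theorem continuousOn_sieveKernel_mul_comp {Φ : ℝ → ℝ} (hΦ : ContinuousOn Φ (Ioi 0)) :
    ContinuousOn (fun t => sieveKernel κ t * Φ (t - 1)) (Ioi 1) :=
  (continuousOn_sieveKernel κ).mul (hΦ.comp (continuousOn_id.sub continuousOn_const)
    fun t (ht : (1 : ℝ) < t) => show (0 : ℝ) < id t - 1 by simp only [id]; linarith)

/-- **`T⁺` is continuous on `(0, ∞)`** (Iwaniec, p. 195: the limit functions are given by (7.7)).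
[cite: IwaniecActaArith1980, Lemma 18] -/
theorem continuousOn_contTLim_one : ContinuousOn (contTLim 1 κ β) (Ioi 0) := by
  have hform : ∀ s ∈ Ioc 0 (β + 1),
      contTLim 1 κ β s = (β + 1) ^ κ - s ^ κ + contTLim 1 κ β (β + 1) :=
    fun s hs => contTLim_one_eq_of_le hκ hβ hbdP hs.1 hs.2
  have hfc : ContinuousOn (fun s : ℝ => (β + 1) ^ κ - s ^ κ + contTLim 1 κ β (β + 1)) (Ioi 0) :=
    (continuousOn_const.sub (continuousOn_id.rpow_const fun s hs => Or.inl (ne_of_gt hs))).add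
      continuousOn_const
  have hprim : ∀ R, β + 1 < R → ContinuousOn (contTLim 1 κ β) (Icc (β + 1) R) := by
    intro R hR
    have hint : IntegrableOn (fun t => sieveKernel κ t * contTLim 0 κ β (t - 1)) (Icc (β + 1) R)
        volume :=
      (integrableOn_Icc_iff_integrableOn_Ioc).mpr
        ((integrableOn_sieveKernel_mul_contTLim_zero hκ hβ hpos hbdM hbdP le_rfl).mono_set
          Ioc_subset_Ioi_self)
    have hint' : IntegrableOn (fun t => sieveKernel κ t * contTLim 0 κ β (t - 1)) (uIcc (β + 1) R)
        volume := by rwa [uIcc_of_le hR.le]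
    have hc := intervalIntegral.continuousOn_primitive_interval hint'
    rw [uIcc_of_le hR.le] at hc
    have hc2 : ContinuousOn (fun x => contTLim 1 κ β (β + 1) -
        ∫ t in (β + 1)..x, sieveKernel κ t * contTLim 0 κ β (t - 1)) (Icc (β + 1) R) :=
      continuousOn_const.sub hc
    refine hc2.congr fun s hs => ?_
    exact contTLim_one_eq_sub_integral hκ hβ hpos hbdM hbdP hs.1
  intro x hx
  have hx0 : (0 : ℝ) < x := hx
  refine ContinuousAt.continuousWithinAt ?_
  rcases lt_trichotomy x (β + 1) with hlt | heq | hgt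
  · refine (hfc.continuousAt (Ioi_mem_nhds hx0)).congr_of_eventuallyEq ?_
    filter_upwards [Ioo_mem_nhds hx0 hlt] with s hs
    exact hform s ⟨hs.1, hs.2.le⟩
  · subst heq
    rw [continuousAt_iff_continuous_left_right]
    constructor
    · have h1 : ContinuousWithinAt (fun s : ℝ => (β + 1) ^ κ - s ^ κ + contTLim 1 κ β (β + 1))
          (Iic (β + 1)) (β + 1) :=
        (hfc.continuousAt (Ioi_mem_nhds hx0)).continuousWithinAt
      refine h1.congr_of_eventuallyEq ?_ (hform _ ⟨hx0, le_rfl⟩)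
      filter_upwards [Ioc_mem_nhdsLE hx0] with s hs using hform s hs
    · exact ((hprim (β + 2) (by linarith)).continuousWithinAt
        ⟨le_rfl, by linarith⟩).mono_of_mem_nhdsWithin (Icc_mem_nhdsGE (by linarith))
  · exact (hprim (x + 1) (by linarith)).continuousAt (Icc_mem_nhds hgt (by linarith))

/-- **`T⁻` is continuous on `[β, ∞)`**. [cite: IwaniecActaArith1980, Lemma 18] -/
theorem continuousOn_contTLim_zero : ContinuousOn (contTLim 0 κ β) (Ici β) := by
  have hprim : ∀ R, β < R → ContinuousOn (contTLim 0 κ β) (Icc β R) := by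
    intro R hR
    have hint : IntegrableOn (fun t => sieveKernel κ t * contTLim 1 κ β (t - 1)) (Icc β R) volume :=
      (integrableOn_Icc_iff_integrableOn_Ioc).mpr
        ((integrableOn_sieveKernel_mul_contTLim_one hκ hβ hpos hbdP le_rfl).mono_set
          Ioc_subset_Ioi_self)
    have hint' : IntegrableOn (fun t => sieveKernel κ t * contTLim 1 κ β (t - 1)) (uIcc β R)
        volume := by rwa [uIcc_of_le hR.le]
    have hc := intervalIntegral.continuousOn_primitive_interval hint'
    rw [uIcc_of_le hR.le] at hc
    have hc2 : ContinuousOn (fun x => contTLim 0 κ β β -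
        ∫ t in β..x, sieveKernel κ t * contTLim 1 κ β (t - 1)) (Icc β R) :=
      continuousOn_const.sub hc
    refine hc2.congr fun s hs => ?_
    exact contTLim_zero_eq_sub_integral hκ hβ hpos hbdM hbdP hs.1
  intro x hx
  rcases eq_or_lt_of_le (show β ≤ x from hx) with heq | hgt
  · subst heq
    exact ((hprim (β + 1) (by linarith)).continuousWithinAt
      ⟨le_rfl, by linarith⟩).mono_of_mem_nhdsWithin (Icc_mem_nhdsGE (by linarith))
  · exact ((hprim (x + 1) (by linarith)).continuousAt
      (Icc_mem_nhds hgt (by linarith))).continuousWithinAt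

/-- **`(T⁻)'(s) = −k(s) T⁺(s − 1)`** for `s > β` (differentiating (7.7)).
[cite: IwaniecActaArith1980, Lemma 18 (7.7)] -/
theorem hasDerivAt_contTLim_zero {s : ℝ} (hs : β < s) :
    HasDerivAt (contTLim 0 κ β) (-(sieveKernel κ s * contTLim 1 κ β (s - 1))) s := by
  have hs1 : 1 < s := by linarith
  have hg : ContinuousOn (fun t => sieveKernel κ t * contTLim 1 κ β (t - 1)) (Ioi 1) :=
    continuousOn_sieveKernel_mul_comp (continuousOn_contTLim_one hκ hβ hpos hbdM hbdP)
  have hint : IntervalIntegrable (fun t => sieveKernel κ t * contTLim 1 κ β (t - 1)) volume β s :=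
    (intervalIntegrable_iff_integrableOn_Ioc_of_le hs.le).mpr
      ((integrableOn_sieveKernel_mul_contTLim_one hκ hβ hpos hbdP le_rfl).mono_set
        Ioc_subset_Ioi_self)
  have hP := intervalIntegral.integral_hasDerivAt_right hint
    (hg.stronglyMeasurableAtFilter isOpen_Ioi s hs1) (hg.continuousAt (Ioi_mem_nhds hs1))
  refine (hP.const_sub (contTLim 0 κ β β)).congr_of_eventuallyEq ?_
  filter_upwards [Ioi_mem_nhds hs] with u hu
  exact contTLim_zero_eq_sub_integral hκ hβ hpos hbdM hbdP hu.le

/-- **`(T⁺)'(s) = −k(s) T⁻(s − 1)`** for `s > β + 1`. [cite: IwaniecActaArith1980, Lemma 18 (7.7)] -/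
theorem hasDerivAt_contTLim_one {s : ℝ} (hs : β + 1 < s) :
    HasDerivAt (contTLim 1 κ β) (-(sieveKernel κ s * contTLim 0 κ β (s - 1))) s := by
  have hs1 : 1 < s := by linarith
  -- the integrand is continuous on `(β + 1, ∞)` (`T⁻` continuous on `[β, ∞)`)
  have hg : ContinuousOn (fun t => sieveKernel κ t * contTLim 0 κ β (t - 1)) (Ioi (β + 1)) :=
    ((continuousOn_sieveKernel κ).mono fun t (ht : β + 1 < t) => show (1 : ℝ) < t by linarith).mul
      ((continuousOn_contTLim_zero hκ hβ hpos hbdM hbdP).comp (continuousOn_id.sub continuousOn_const)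
        fun t (ht : β + 1 < t) => show β ≤ id t - 1 by simp only [id]; linarith)
  have hint :
      IntervalIntegrable (fun t => sieveKernel κ t * contTLim 0 κ β (t - 1)) volume (β + 1) s :=
    (intervalIntegrable_iff_integrableOn_Ioc_of_le hs.le).mpr
      ((integrableOn_sieveKernel_mul_contTLim_zero hκ hβ hpos hbdM hbdP le_rfl).mono_set
        Ioc_subset_Ioi_self)
  have hP := intervalIntegral.integral_hasDerivAt_right hint
    (hg.stronglyMeasurableAtFilter isOpen_Ioi s hs) (hg.continuousAt (Ioi_mem_nhds hs))
  refine (hP.const_sub (contTLim 1 κ β (β + 1))).congr_of_eventuallyEq ?_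
  filter_upwards [Ioi_mem_nhds hs] with u hu
  exact contTLim_one_eq_sub_integral hκ hβ hpos hbdM hbdP hu.le

end Regularity

/-! ### The candidate functions `F̃ = 1 + s^{−κ} T⁺`, `f̃ = 1 − s^{−κ} T⁻` (Iwaniec, p. 202) -/

/-- `F̃(s) = 1 + s^{−κ} T⁺(s)` (Iwaniec, p. 202: `F(s) = 1 + s^{−κ} T⁺(s)`).
[cite: IwaniecActaArith1980, §9 (p. 202)] -/
def candUpper (κ β s : ℝ) : ℝ := 1 + s ^ (-κ) * contTLim 1 κ β s

/-- `Ã = (β + 1)^κ + T⁺(β + 1)` (Iwaniec, p. 195: `A = T⁺(β) + β^κ`, equivalently at `β + 1` by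
(7.7)). [cite: IwaniecActaArith1980, §7 (p. 195)] -/
def candConst (κ β : ℝ) : ℝ := (β + 1) ^ κ + contTLim 1 κ β (β + 1)

/-- `B̃ = β^κ − T⁻(β)` (Iwaniec, p. 195: `B = T⁻(β) − β^κ`, up to sign).
[cite: IwaniecActaArith1980, §7 (p. 195)] -/
def candB (κ β : ℝ) : ℝ := β ^ κ - contTLim 0 κ β β

/-- `f̃(s) = 1 − s^{−κ} T⁻(s)` for `s > β`, continued by `B̃ s^{−κ}` on `(0, β]` (Iwaniec, p. 202 and
(1.9): `s^κ f(s) = B` for `s ≤ β`). [cite: IwaniecActaArith1980, §9 (p. 202)] -/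
def candLower (κ β s : ℝ) : ℝ :=
  if s ≤ β then candB κ β * s ^ (-κ) else 1 - s ^ (-κ) * contTLim 0 κ β s

section Candidate

variable (hκ : 0 < κ) (hβ : 1 < β) {c : ℝ}
  (hpos : ∀ u : ℝ, 0 < u → 0 < qUpper κ β u ∧ 0 < qLower κ β u)
  (hbdM : ∀ (N : ℕ) (u : ℝ), β ≤ u → contT 0 κ β N u ≤ c * qLower κ β u)
  (hbdP : ∀ (N : ℕ) (u : ℝ), β - 1 ≤ u → contT 1 κ β N u ≤ c * qUpper κ β u)
include hκ hβ hpos hbdM hbdP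

omit hpos hbdM in
/-- `F̃(s) = Ã s^{−κ}` on `(0, β + 1]` ((1.8)). [cite: IwaniecActaArith1980, (1.8)] -/
theorem candUpper_eq {s : ℝ} (hs0 : 0 < s) (hs : s ≤ β + 1) :
    candUpper κ β s = candConst κ β * s ^ (-κ) := by
  rw [candUpper, candConst, contTLim_one_eq_of_le hκ hβ hbdP hs0 hs]
  have e : s ^ (-κ) * s ^ κ = 1 := by
    rw [Real.rpow_neg hs0.le, inv_mul_cancel₀ (Real.rpow_pos_of_pos hs0 κ).ne']
  linear_combination (-1 : ℝ) * e

omit hκ hβ hpos hbdM hbdP in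
/-- `f̃(s) = B̃ s^{−κ}` on `(0, β]` ((1.9)). [cite: IwaniecActaArith1980, (1.9)] -/
theorem candLower_eq_of_le {s : ℝ} (hs : s ≤ β) : candLower κ β s = candB κ β * s ^ (-κ) := by
  rw [candLower, if_pos hs]

omit hκ hβ hpos hbdM hbdP in
/-- `f̃(s) = 1 − s^{−κ} T⁻(s)` for `s > β`. [folklore] -/
theorem candLower_eq_of_lt {s : ℝ} (hs : β < s) :
    candLower κ β s = 1 - s ^ (-κ) * contTLim 0 κ β s := by
  rw [candLower, if_neg (not_le.mpr hs)]

omit hpos hbdM in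
/-- `Ã > 0`. [folklore] -/
theorem candConst_pos : 0 < candConst κ β := by
  have h1 : 0 < (β + 1) ^ κ := Real.rpow_pos_of_pos (by linarith) κ
  have h2 : 0 ≤ contTLim 1 κ β (β + 1) :=
    contTLim_nonneg hκ.le hβ.le 1 (by linarith) fun N => hbdP N _ (by linarith)
  rw [candConst]; linarith

/-- **The `f`-equation (1.9) for the candidates**: `(s^κ f̃(s))' = κ s^{κ−1} F̃(s − 1)` for `s > β`
(from `(T⁻)' = −k T⁺(· − 1)`). [cite: IwaniecActaArith1980, (1.8)–(1.9)] -/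
theorem hasDerivAt_candLower {s : ℝ} (hs : β < s) :
    HasDerivAt (fun t : ℝ => t ^ κ * candLower κ β t)
      (κ * s ^ (κ - 1) * candUpper κ β (s - 1)) s := by
  have hs0 : 0 < s := by linarith
  -- near `s`: `t^κ f̃(t) = t^κ − T⁻(t)`
  have heq : (fun t : ℝ => t ^ κ * candLower κ β t) =ᶠ[𝓝 s] fun t => t ^ κ - contTLim 0 κ β t := by
    filter_upwards [Ioi_mem_nhds hs, Ioi_mem_nhds hs0] with t (ht : β < t) (ht0 : 0 < t)
    rw [candLower_eq_of_lt ht, mul_sub, mul_one, ← mul_assoc, ← Real.rpow_add ht0, add_neg_cancel,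
      Real.rpow_zero, one_mul]
  have h1 : HasDerivAt (fun t : ℝ => t ^ κ) (κ * s ^ (κ - 1)) s := by
    simpa using (hasDerivAt_id s).rpow_const (p := κ) (Or.inl hs0.ne')
  have h2 := hasDerivAt_contTLim_zero hκ hβ hpos hbdM hbdP hs
  refine ((h1.sub h2).congr_of_eventuallyEq heq).congr_deriv ?_
  rw [candUpper, sieveKernel]
  ring

/-- **The `F`-equation (1.8) for the candidates**: `(s^κ F̃(s))' = κ s^{κ−1} f̃(s − 1)` for
`s > β + 1` (from `(T⁺)' = −k T⁻(· − 1)`). [cite: IwaniecActaArith1980, (1.8)–(1.9)] -/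
theorem hasDerivAt_candUpper {s : ℝ} (hs : β + 1 < s) :
    HasDerivAt (fun t : ℝ => t ^ κ * candUpper κ β t)
      (κ * s ^ (κ - 1) * candLower κ β (s - 1)) s := by
  have hs0 : 0 < s := by linarith
  have heq : (fun t : ℝ => t ^ κ * candUpper κ β t) =ᶠ[𝓝 s] fun t => t ^ κ + contTLim 1 κ β t := by
    filter_upwards [Ioi_mem_nhds hs0] with t (ht0 : 0 < t)
    rw [candUpper, mul_add, mul_one, ← mul_assoc, ← Real.rpow_add ht0, add_neg_cancel, Real.rpow_zero,
      one_mul]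
  have h1 : HasDerivAt (fun t : ℝ => t ^ κ) (κ * s ^ (κ - 1)) s := by
    simpa using (hasDerivAt_id s).rpow_const (p := κ) (Or.inl hs0.ne')
  have h2 := hasDerivAt_contTLim_one hκ hβ hpos hbdM hbdP hs
  refine ((h1.add h2).congr_of_eventuallyEq heq).congr_deriv ?_
  rw [candLower_eq_of_lt (by linarith : β < s - 1), sieveKernel]
  ring

/-- `F̃` is continuous on `(0, ∞)`. [folklore] -/
theorem continuousOn_candUpper : ContinuousOn (candUpper κ β) (Ioi 0) :=
  continuousOn_const.add ((continuousOn_id.rpow_const fun _ hs => Or.inl (ne_of_gt hs)).mul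
    (continuousOn_contTLim_one hκ hβ hpos hbdM hbdP))

/-- `f̃` is continuous on `(0, ∞)` (the two pieces agree at `β`: `B̃ β^{−κ} = 1 − β^{−κ} T⁻(β)`).
[folklore] -/
theorem continuousOn_candLower : ContinuousOn (candLower κ β) (Ioi 0) := by
  have hβ0 : 0 < β := by linarith
  have hleft : ContinuousOn (fun s : ℝ => candB κ β * s ^ (-κ)) (Ioi 0) :=
    continuousOn_const.mul (continuousOn_id.rpow_const fun s hs => Or.inl (ne_of_gt hs))
  have hright : ContinuousOn (fun s : ℝ => 1 - s ^ (-κ) * contTLim 0 κ β s) (Ici β) :=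
    continuousOn_const.sub (((continuousOn_id.rpow_const fun s hs =>
      Or.inl (ne_of_gt (lt_of_lt_of_le hβ0 hs)))).mul
        (continuousOn_contTLim_zero hκ hβ hpos hbdM hbdP))
  have hmatch : candB κ β * β ^ (-κ) = 1 - β ^ (-κ) * contTLim 0 κ β β := by
    rw [candB, sub_mul, Real.rpow_neg hβ0.le, mul_inv_cancel₀ (Real.rpow_pos_of_pos hβ0 κ).ne']
    ring
  intro x hx
  have hx0 : (0 : ℝ) < x := hx
  refine ContinuousAt.continuousWithinAt ?_
  rcases lt_trichotomy x β with hlt | heq | hgt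
  · refine (hleft.continuousAt (Ioi_mem_nhds hx0)).congr_of_eventuallyEq ?_
    filter_upwards [Iio_mem_nhds hlt] with s hs using candLower_eq_of_le hs.le
  · subst heq
    rw [continuousAt_iff_continuous_left_right]
    constructor
    · refine ((hleft.continuousAt (Ioi_mem_nhds hx0)).continuousWithinAt).congr_of_eventuallyEq
        ?_ (candLower_eq_of_le le_rfl)
      filter_upwards [self_mem_nhdsWithin] with s hs using candLower_eq_of_le hs
    · have hg : ContinuousWithinAt (fun s : ℝ => 1 - s ^ (-κ) * contTLim 0 κ x s) (Ici x) x :=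
        hright x self_mem_Ici
      refine hg.congr_of_eventuallyEq ?_ ?_
      · filter_upwards [self_mem_nhdsWithin] with s hs
        rcases eq_or_lt_of_le (show x ≤ s from hs) with h | h
        · rw [← h, candLower_eq_of_le le_rfl, hmatch]
        · exact candLower_eq_of_lt h
      · rw [candLower_eq_of_le le_rfl, hmatch]
  · have hg : ContinuousAt (fun s : ℝ => 1 - s ^ (-κ) * contTLim 0 κ β s) x :=
      (hright.mono Ioi_subset_Ici_self).continuousAt (Ioi_mem_nhds hgt)
    refine hg.congr_of_eventuallyEq ?_
    filter_upwards [Ioi_mem_nhds hgt] with s hs using candLower_eq_of_lt hs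

end Candidate


/-- `Q̃ = F̃ − f̃` (Iwaniec's `m(s) = s^{−κ}(T⁺(s) + T⁻(s))`, p. 195).
[cite: IwaniecActaArith1980, §7 (p. 195)] -/
def candDiff (κ β s : ℝ) : ℝ := candUpper κ β s - candLower κ β s

section BZero

variable (hκ : 0 < κ) (hβ : 1 < β) {c : ℝ}
  (hpos : ∀ u : ℝ, 0 < u → 0 < qUpper κ β u ∧ 0 < qLower κ β u)
  (hbdM : ∀ (N : ℕ) (u : ℝ), β ≤ u → contT 0 κ β N u ≤ c * qLower κ β u)
  (hbdP : ∀ (N : ℕ) (u : ℝ), β - 1 ≤ u → contT 1 κ β N u ≤ c * qUpper κ β u)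
include hκ hβ hpos hbdM hbdP

omit hpos hbdM in
/-- `Q̃(x) = (Ã − B̃) x^{−κ}` on `(0, β]` ((7.8)–(7.9) at `s = β`).
[cite: IwaniecActaArith1980, §7 (7.8)–(7.9)] -/
theorem candDiff_eq_of_le {x : ℝ} (hx0 : 0 < x) (hx : x ≤ β) :
    candDiff κ β x = (candConst κ β - candB κ β) * x ^ (-κ) := by
  rw [candDiff, candUpper_eq hκ hβ hbdP hx0 (by linarith), candLower_eq_of_le hx]
  ring

/-- `Q̃` is continuous on `(0, ∞)`. [folklore] -/
theorem continuousOn_candDiff : ContinuousOn (candDiff κ β) (Ioi 0) :=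
  (continuousOn_candUpper hκ hβ hpos hbdM hbdP).sub (continuousOn_candLower hκ hβ hpos hbdM hbdP)

/-- The derivative of `W = s^κ Q̃` on `(β, β + 1)`: `W'(s) = −κ s^{κ−1} Ã (s − 1)^{−κ}` (there
`s^κ F̃ = Ã` is constant and `(s^κ f̃)' = κ s^{κ−1} F̃(s − 1)`). [folklore] -/
theorem hasDerivAt_rpow_mul_candDiff_of_lt {s : ℝ} (hs : β < s) (hs' : s < β + 1) :
    HasDerivAt (fun t : ℝ => t ^ κ * candDiff κ β t)
      (-(κ * s ^ (κ - 1) * (candConst κ β * (s - 1) ^ (-κ)))) s := by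
  have hs0 : 0 < s := by linarith
  -- `t^κ F̃(t) = Ã` near `s`
  have hF : HasDerivAt (fun t : ℝ => t ^ κ * candUpper κ β t) 0 s := by
    refine (hasDerivAt_const s (candConst κ β)).congr_of_eventuallyEq ?_
    filter_upwards [Ioo_mem_nhds hs0 hs'] with t ht
    rw [candUpper_eq hκ hβ hbdP ht.1 ht.2.le, ← mul_assoc, mul_comm (t ^ κ), mul_assoc,
      Real.rpow_neg ht.1.le, mul_inv_cancel₀ (Real.rpow_pos_of_pos ht.1 κ).ne', mul_one]
  have hf := hasDerivAt_candLower hκ hβ hpos hbdM hbdP hs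
  have hF1 : candUpper κ β (s - 1) = candConst κ β * (s - 1) ^ (-κ) :=
    candUpper_eq hκ hβ hbdP (by linarith) (by linarith)
  have h := hF.sub hf
  rw [hF1] at h
  refine (h.congr_of_eventuallyEq (Eventually.of_forall fun t => ?_)).congr_deriv (by ring)
  simp only [candDiff, mul_sub, Pi.sub_apply]

/-- The derivative of `W = s^κ Q̃` on `(β + 1, ∞)`: `W'(s) = −κ s^{κ−1} Q̃(s − 1)` (the `Q`-equation
(5.1) with `a = b = κ`, i.e. Greaves (4.2.1.13)). [cite: IwaniecActaArith1980, §7 (7.10)] -/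
theorem hasDerivAt_rpow_mul_candDiff_of_gt {s : ℝ} (hs : β + 1 < s) :
    HasDerivAt (fun t : ℝ => t ^ κ * candDiff κ β t)
      (-(κ * s ^ (κ - 1) * candDiff κ β (s - 1))) s := by
  have hF := hasDerivAt_candUpper hκ hβ hpos hbdM hbdP hs
  have hf := hasDerivAt_candLower hκ hβ hpos hbdM hbdP (by linarith : β < s)
  refine ((hF.sub hf).congr_of_eventuallyEq (Eventually.of_forall fun t => ?_)).congr_deriv ?_
  · simp only [candDiff, mul_sub, Pi.sub_apply]
  · rw [candDiff]; ring

end BZero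

section BZero2

variable (hκ : 0 < κ) (hβ : 1 < β) {c : ℝ}
  (hpos : ∀ u : ℝ, 0 < u → 0 < qUpper κ β u ∧ 0 < qLower κ β u)
  (hbdM : ∀ (N : ℕ) (u : ℝ), β ≤ u → contT 0 κ β N u ≤ c * qLower κ β u)
  (hbdP : ∀ (N : ℕ) (u : ℝ), β - 1 ≤ u → contT 1 κ β N u ≤ c * qUpper κ β u)
include hκ hβ hpos hbdM hbdP

omit hκ hβ hpos hbdM hbdP in
/-- `Q̃` is differentiable wherever `W = s^κ Q̃` is (`s > 0`), with
`Q̃' = −κ s^{−κ−1} W + s^{−κ} W'`. [folklore] -/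
theorem hasDerivAt_candDiff {s W' : ℝ} (hs0 : 0 < s)
    (hW : HasDerivAt (fun t : ℝ => t ^ κ * candDiff κ β t) W' s) :
    HasDerivAt (candDiff κ β) (-κ * s ^ (-κ - 1) * (s ^ κ * candDiff κ β s) + s ^ (-κ) * W') s := by
  have h1 : HasDerivAt (fun t : ℝ => t ^ (-κ)) (-κ * s ^ (-κ - 1)) s := by
    simpa using (hasDerivAt_id s).rpow_const (p := -κ) (Or.inl hs0.ne')
  have h := h1.mul hW
  refine h.congr_of_eventuallyEq ?_
  filter_upwards [Ioi_mem_nhds hs0] with t (ht : 0 < t)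
  show candDiff κ β t = t ^ (-κ) * (t ^ κ * candDiff κ β t)
  rw [← mul_assoc, Real.rpow_neg ht.le, inv_mul_cancel₀ (Real.rpow_pos_of_pos ht κ).ne', one_mul]

/-- **The derivative of the inner product `⟨Q̃, g⟩` on `(β, β + 1)`**: `−κ B̃ g(s) (s − 1)^{−κ}`
(the inhomogeneity of the `Q`-equation there is `−κ B̃ (s − 1)^{−κ}`). Here `g = qFun κ` is
Iwaniec's adjoint `g` (= Greaves' `q_κ`, `SieveFunctionsAdjoint.lean`).
[cite: IwaniecActaArith1980, §7 (7.10)–(7.12)] -/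
theorem hasDerivAt_innerProduct_of_lt {s : ℝ} (hs : β < s) (hs' : s < β + 1) :
    HasDerivAt (sieveInnerProduct κ (candDiff κ β) (qFun κ))
      (qFun κ s * (-κ * candB κ β * (s - 1) ^ (-κ))) s := by
  have hs0 : 0 < s := by linarith
  have hs1 : 0 < s - 1 := by linarith
  have hW := hasDerivAt_rpow_mul_candDiff_of_lt hκ hβ hpos hbdM hbdP hs hs'
  have hQ := hasDerivAt_candDiff hs0 hW
  have hQ1 : candDiff κ β (s - 1) = (candConst κ β - candB κ β) * (s - 1) ^ (-κ) :=
    candDiff_eq_of_le hκ hβ hbdP hs1 (by linarith)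
  refine hasDerivAt_sieveInnerProduct_inhom (a := κ) (d := 0) (by linarith) hQ ?_
    (hasDerivAt_mul_qFun κ hs0) ?_
  · -- `s Q̃' = -κ Q̃ - κ Q̃(s-1) + E`, `E = -κ B̃ (s-1)^{-κ}`
    rw [hQ1]
    have e1 : s * s ^ (-κ - 1) = s ^ (-κ) := by
      rw [show (-κ - 1 : ℝ) = -κ + (-1) by ring, Real.rpow_add hs0, Real.rpow_neg_one]
      field_simp
    have e2 : s * s ^ (-κ) * s ^ (κ - 1) = 1 := by
      rw [mul_assoc, ← Real.rpow_add hs0, show -κ + (κ - 1) = (-1 : ℝ) by ring, Real.rpow_neg_one,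
        mul_inv_cancel₀ hs0.ne']
    have e3 : s ^ (-κ) * s ^ κ = 1 := by
      rw [Real.rpow_neg hs0.le, inv_mul_cancel₀ (Real.rpow_pos_of_pos hs0 κ).ne']
    calc s * (-κ * s ^ (-κ - 1) * (s ^ κ * candDiff κ β s) +
          s ^ (-κ) * -(κ * s ^ (κ - 1) * (candConst κ β * (s - 1) ^ (-κ))))
        = -κ * (s * s ^ (-κ - 1)) * s ^ κ * candDiff κ β s -
            κ * (s * s ^ (-κ) * s ^ (κ - 1)) * (candConst κ β * (s - 1) ^ (-κ)) := by ring
      _ = -κ * candDiff κ β s - κ * ((candConst κ β - candB κ β) * (s - 1) ^ (-κ)) +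
            (-κ * candB κ β * (s - 1) ^ (-κ)) := by
          rw [e1, e2]; linear_combination (-κ * candDiff κ β s) * e3
  · exact (continuousOn_comp_add_one (continuousOn_qFun κ)).mul
      (continuousOn_candDiff hκ hβ hpos hbdM hbdP)

/-- **The inner product `⟨Q̃, g⟩` is constant on `(β + 1, ∞)`** (there `Q̃` solves the homogeneous
`Q`-equation; Greaves Lemma 4.2.1). [cite: IwaniecActaArith1980, §7 (7.10)–(7.12)] -/
theorem hasDerivAt_innerProduct_of_gt {s : ℝ} (hs : β + 1 < s) :
    HasDerivAt (sieveInnerProduct κ (candDiff κ β) (qFun κ)) 0 s := by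
  have hs0 : 0 < s := by linarith
  have hW := hasDerivAt_rpow_mul_candDiff_of_gt hκ hβ hpos hbdM hbdP hs
  have hQ := hasDerivAt_candDiff hs0 hW
  have h := hasDerivAt_sieveInnerProduct_inhom (a := κ) (E := 0) (d := 0) (by linarith) hQ ?_
    (hasDerivAt_mul_qFun κ hs0)
    ((continuousOn_comp_add_one (continuousOn_qFun κ)).mul
      (continuousOn_candDiff hκ hβ hpos hbdM hbdP))
  · simpa using h
  · have e1 : s * s ^ (-κ - 1) = s ^ (-κ) := by
      rw [show (-κ - 1 : ℝ) = -κ + (-1) by ring, Real.rpow_add hs0, Real.rpow_neg_one]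
      field_simp
    have e2 : s * s ^ (-κ) * s ^ (κ - 1) = 1 := by
      rw [mul_assoc, ← Real.rpow_add hs0, show -κ + (κ - 1) = (-1 : ℝ) by ring, Real.rpow_neg_one,
        mul_inv_cancel₀ hs0.ne']
    have e3 : s ^ (-κ) * s ^ κ = 1 := by
      rw [Real.rpow_neg hs0.le, inv_mul_cancel₀ (Real.rpow_pos_of_pos hs0 κ).ne']
    calc s * (-κ * s ^ (-κ - 1) * (s ^ κ * candDiff κ β s) +
          s ^ (-κ) * -(κ * s ^ (κ - 1) * candDiff κ β (s - 1)))
        = -κ * (s * s ^ (-κ - 1)) * s ^ κ * candDiff κ β s -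
            κ * (s * s ^ (-κ) * s ^ (κ - 1)) * candDiff κ β (s - 1) := by ring
      _ = -κ * candDiff κ β s - κ * candDiff κ β (s - 1) + 0 := by
          rw [e1, e2]; linear_combination (-κ * candDiff κ β s) * e3

/-- The inner product `⟨Q̃, g⟩` is continuous on `(1, ∞)`. [folklore] -/
theorem continuousOn_innerProduct :
    ContinuousOn (sieveInnerProduct κ (candDiff κ β) (qFun κ)) (Ioi 1) := by
  have hQ := continuousOn_candDiff hκ hβ hpos hbdM hbdP
  have hg := continuousOn_qFun κ
  have hprod : ContinuousOn (fun x => qFun κ (x + 1) * candDiff κ β x) (Ioi 0) :=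
    (continuousOn_comp_add_one hg).mul hQ
  have h1 : ContinuousOn (fun s => s * qFun κ s * candDiff κ β s) (Ioi 1) :=
    ((continuousOn_id.mul (hg.mono fun s (hs : 1 < s) => show (0:ℝ) < s by linarith)).mul
      (hQ.mono fun s (hs : 1 < s) => show (0:ℝ) < s by linarith))
  have h2 : ContinuousOn (fun u => ∫ x in (u - 1)..u, qFun κ (x + 1) * candDiff κ β x) (Ioi 1) :=
    fun u (hu : 1 < u) =>
      (hasDerivAt_integral_sub_one (d := 0) (by linarith) hprod).continuousAt.continuousWithinAt
  exact h1.sub (continuousOn_const.mul h2)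

omit hpos hbdM in
/-- **The value at `β`**: `⟨Q̃, g⟩(β) = (Ã − B̃)(β − 1)^{1−κ} g(β − 1)` ((7.12); Greaves Lemma 4.2.1
(ii): on `[β − 1, β]` one has `Q̃(x) = (Ã − B̃) x^{−κ}` and `κ x^{−κ} g(x + 1) = (x^{1−κ} g)'`).
[cite: IwaniecActaArith1980, §7 (7.12)] -/
theorem innerProduct_beta :
    sieveInnerProduct κ (candDiff κ β) (qFun κ) β =
      (candConst κ β - candB κ β) * (β - 1) ^ (1 - κ) * qFun κ (β - 1) := by
  have hβ0 : 0 < β := by linarith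
  have hβ1 : 0 < β - 1 := by linarith
  set D := candConst κ β - candB κ β with hD
  -- the adjoint identity `κ ∫_{β-1}^{β} x^{-κ} g(x+1) dx = β^{1-κ} g(β) - (β-1)^{1-κ} g(β-1)`
  have hadj : ∀ t, 0 < t → HasDerivAt (fun x : ℝ => x ^ (1 - κ) * qFun κ x)
      (κ * t ^ (-κ) * qFun κ (t + 1)) t := isSieveAdjoint_qFun κ
  have hderc : ContinuousOn (fun t : ℝ => κ * t ^ (-κ) * qFun κ (t + 1)) (Ioi 0) :=
    (continuousOn_const.mul (continuousOn_id.rpow_const fun t ht => Or.inl (ne_of_gt ht))).mul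
      (continuousOn_comp_add_one (continuousOn_qFun κ))
  have hK : ∫ x in (β - 1)..β, κ * x ^ (-κ) * qFun κ (x + 1) =
      β ^ (1 - κ) * qFun κ β - (β - 1) ^ (1 - κ) * qFun κ (β - 1) := by
    refine intervalIntegral.integral_eq_sub_of_hasDerivAt (fun x hx => hadj x ?_) ?_
    · rw [Set.uIcc_of_le (by linarith)] at hx; linarith [hx.1]
    · exact ((hderc.mono fun x hx => by
        rw [Set.uIcc_of_le (by linarith)] at hx
        exact show (0:ℝ) < x by linarith [hx.1])).intervalIntegrable
  -- the integral in the inner product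
  have hI : ∫ x in (β - 1)..β, qFun κ (x + 1) * candDiff κ β x =
      D * (1 / κ) * (β ^ (1 - κ) * qFun κ β - (β - 1) ^ (1 - κ) * qFun κ (β - 1)) := by
    rw [← hK, ← intervalIntegral.integral_const_mul]
    refine intervalIntegral.integral_congr fun x hx => ?_
    rw [Set.uIcc_of_le (by linarith)] at hx
    have hx0 : 0 < x := by linarith [hx.1]
    rw [candDiff_eq_of_le hκ hβ hbdP hx0 hx.2, ← hD]
    field_simp
  rw [sieveInnerProduct, hI, candDiff_eq_of_le hκ hβ hbdP hβ0 le_rfl, ← hD,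
    show (1 - κ : ℝ) = -κ + 1 by ring, Real.rpow_add hβ0, Real.rpow_one]
  field_simp
  ring

end BZero2

section BZero3

variable (hκ : 0 < κ) (hβ : 1 < β) {c : ℝ}
  (hpos : ∀ u : ℝ, 0 < u → 0 < qUpper κ β u ∧ 0 < qLower κ β u)
  (hbdM : ∀ (N : ℕ) (u : ℝ), β ≤ u → contT 0 κ β N u ≤ c * qLower κ β u)
  (hbdP : ∀ (N : ℕ) (u : ℝ), β - 1 ≤ u → contT 1 κ β N u ≤ c * qUpper κ β u)
include hκ hβ hpos hbdM hbdP

omit hκ hpos hbdM hbdP in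
/-- The adjoint identity `κ ∫_{β−1}^{β} x^{−κ} g(x + 1) dx = β^{1−κ} g(β) − (β − 1)^{1−κ} g(β − 1)`
(`(x^{1−κ} g)' = κ x^{−κ} g(x + 1)`, `IsSieveAdjoint κ κ g`). [cite: Greaves2001, §4.2.2 (2.10)] -/
theorem integral_adjoint_eq :
    ∫ x in (β - 1)..β, κ * x ^ (-κ) * qFun κ (x + 1) =
      β ^ (1 - κ) * qFun κ β - (β - 1) ^ (1 - κ) * qFun κ (β - 1) := by
  have hadj : ∀ t, 0 < t → HasDerivAt (fun x : ℝ => x ^ (1 - κ) * qFun κ x)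
      (κ * t ^ (-κ) * qFun κ (t + 1)) t := isSieveAdjoint_qFun κ
  have hderc : ContinuousOn (fun t : ℝ => κ * t ^ (-κ) * qFun κ (t + 1)) (Ioi 0) :=
    (continuousOn_const.mul (continuousOn_id.rpow_const fun t ht => Or.inl (ne_of_gt ht))).mul
      (continuousOn_comp_add_one (continuousOn_qFun κ))
  refine intervalIntegral.integral_eq_sub_of_hasDerivAt (fun x hx => hadj x ?_) ?_
  · rw [Set.uIcc_of_le (by linarith)] at hx; linarith [hx.1]
  · exact ((hderc.mono fun x hx => by
      rw [Set.uIcc_of_le (by linarith)] at hx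
      exact show (0:ℝ) < x by linarith [hx.1])).intervalIntegrable

/-- **The inner product beyond `β + 1`**: for `R ≥ β + 1`,
`⟨Q̃, g⟩(R) = ⟨Q̃, g⟩(β) − B̃ [β^{1−κ} g(β) − (β − 1)^{1−κ} g(β − 1)]` (integrate the derivative over
`[β, β + 1]`, then constancy). [cite: IwaniecActaArith1980, §7 (7.12)] -/
theorem innerProduct_eq_of_ge {R : ℝ} (hR : β + 1 ≤ R) :
    sieveInnerProduct κ (candDiff κ β) (qFun κ) R =
      sieveInnerProduct κ (candDiff κ β) (qFun κ) β -
        candB κ β * (β ^ (1 - κ) * qFun κ β - (β - 1) ^ (1 - κ) * qFun κ (β - 1)) := by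
  set I := sieveInnerProduct κ (candDiff κ β) (qFun κ) with hIdef
  have hIc := continuousOn_innerProduct hκ hβ hpos hbdM hbdP
  -- over `[β, β + 1]`
  have hderc :
      ContinuousOn (fun s : ℝ => qFun κ s * (-κ * candB κ β * (s - 1) ^ (-κ))) (Icc β (β + 1)) := by
    refine ((continuousOn_qFun κ).mono fun s hs => show (0:ℝ) < s by linarith [hs.1]).mul
      (continuousOn_const.mul ((continuousOn_id.sub continuousOn_const).rpow_const fun s hs =>
        Or.inl (sub_ne_zero.mpr (by simp only [id]; linarith [hs.1]))))
  have h1 : ∫ s in β..(β + 1), qFun κ s * (-κ * candB κ β * (s - 1) ^ (-κ)) = I (β + 1) - I β :=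
    intervalIntegral.integral_eq_sub_of_hasDerivAt_of_le (by linarith)
      (hIc.mono fun s hs => show (1:ℝ) < s by linarith [hs.1])
      (fun s hs => hasDerivAt_innerProduct_of_lt hκ hβ hpos hbdM hbdP hs.1 hs.2)
      (hderc.mono (by rw [Set.uIcc_of_le (by linarith)])).intervalIntegrable
  have h2 : ∫ s in β..(β + 1), qFun κ s * (-κ * candB κ β * (s - 1) ^ (-κ)) =
      -candB κ β * (β ^ (1 - κ) * qFun κ β - (β - 1) ^ (1 - κ) * qFun κ (β - 1)) := by
    rw [← integral_adjoint_eq (κ := κ) hβ, ← intervalIntegral.integral_const_mul]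
    have hsub := intervalIntegral.integral_comp_sub_right
      (fun x : ℝ => -candB κ β * (κ * x ^ (-κ) * qFun κ (x + 1))) (1 : ℝ) (a := β) (b := β + 1)
    rw [show β + 1 - 1 = β by ring] at hsub
    rw [← hsub]
    refine intervalIntegral.integral_congr fun s _ => ?_
    simp only [sub_add_cancel]
    ring
  -- beyond `β + 1`
  have h3 : I R = I (β + 1) := by
    rcases eq_or_lt_of_le hR with h | h
    · rw [h]
    · exact eq_of_hasDerivAt_zero_Ioo h (hIc.mono fun s hs => show (1:ℝ) < s by linarith [hs.1])
        fun s hs => hasDerivAt_innerProduct_of_gt hκ hβ hpos hbdM hbdP hs.1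
  linarith

/-- **`B̃ = 0`** (Iwaniec, p. 196: "For `κ > 1/2` we have `β > 1` and `g(β − 1) = 0`. Thus `B = 0`"):
if the inner product `⟨Q̃, g⟩(s)` tends to `0` at infinity, `g(β − 1) = 0` and `g(β) ≠ 0`, then
`B̃ = 0`. [cite: IwaniecActaArith1980, §7 (7.12) and p. 196] -/
theorem candB_eq_zero (hI : Tendsto (sieveInnerProduct κ (candDiff κ β) (qFun κ)) atTop (𝓝 0))
    (hg1 : qFun κ (β - 1) = 0) (hg2 : qFun κ β ≠ 0) : candB κ β = 0 := by
  have hβ0 : 0 < β := by linarith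
  have hev : (sieveInnerProduct κ (candDiff κ β) (qFun κ)) =ᶠ[atTop]
      fun _ => -(candB κ β * (β ^ (1 - κ) * qFun κ β)) := by
    filter_upwards [eventually_ge_atTop (β + 1)] with R hR
    rw [innerProduct_eq_of_ge hκ hβ hpos hbdM hbdP hR, innerProduct_beta hκ hβ hbdP, hg1]
    ring
  have hlim := (tendsto_nhds_unique (hI.congr' hev) tendsto_const_nhds)
  have hpow : 0 < β ^ (1 - κ) := Real.rpow_pos_of_pos hβ0 _
  have : candB κ β * (β ^ (1 - κ) * qFun κ β) = 0 := by linarith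
  rcases mul_eq_zero.mp this with h | h
  · exact h
  · exfalso; exact hg2 ((mul_eq_zero.mp h).resolve_left hpow.ne')

end BZero3

/-! ### Decay: consequences of (6.3) and (6.5) (Lemma 13) -/

section Decay

/-- **From (6.5): `q⁺(s) ≤ e^{−Ms}` eventually**, for every `M` (super-exponential decay of `Q⁺`),
granted Lemma 13. [cite: IwaniecActaArith1980, Lemma 13 (6.5)] -/
theorem _root_.Literature.NumberTheory.Sieve.RosserMajorant.Iwaniec1980_lemma13.eventually_qUpper_le_exp
    (h13 : RosserMajorant.Iwaniec1980_lemma13) {κ : ℝ} (hκ : 1 / 2 < κ)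
    {B : (ℝ → ℝ) × (ℝ → ℝ) × ℝ × ℝ} (hB : IsGreatestBetaSieveData κ B) (M : ℝ) :
    ∀ᶠ s in atTop, qUpper κ B.2.2.1 s ≤ Real.exp (-(M * s)) := by
  obtain ⟨-, hpos, c₁, c₂, C, hc₁, hbounds⟩ := h13 hκ B hB
  have hκ0 : 0 < κ := by linarith
  set M₀ : ℝ := κ + 3 + |Real.log κ| + |C| + |M| with hM₀
  filter_upwards [eventually_ge_atTop (max (Real.exp M₀) 3)] with s hs
  have hs3 : 3 ≤ s := le_trans (le_max_right _ _) hs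
  have hsM : Real.exp M₀ ≤ s := le_trans (le_max_left _ _) hs
  have hs0 : 0 < s := by linarith
  have hq := (hpos s hs0).1
  have h65 := (hbounds s (by linarith)).2.2.2.2
  have hlogs : 1 ≤ Real.log s := by
    rw [← Real.log_exp 1]
    exact Real.log_le_log (Real.exp_pos 1) (by linarith [Real.exp_one_lt_d9.le])
  have hlogsM : M₀ ≤ Real.log s := by
    rw [← Real.log_exp M₀]; exact Real.log_le_log (Real.exp_pos M₀) hsM
  have hlogs_le : Real.log s ≤ s := (Real.log_le_sub_one_of_pos hs0).trans (by linarith)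
  have hll0 : 0 ≤ Real.log (Real.log s) := Real.log_nonneg hlogs
  have hll2 : Real.log (Real.log (2 * s)) ≤ Real.log s := log_log_two_mul_le (by linarith)
  have hfrac_nonneg : 0 ≤ s * Real.log (Real.log (2 * s)) / Real.log s := by
    have : 0 ≤ Real.log (Real.log (2 * s)) := by
      refine Real.log_nonneg ?_
      rw [← Real.log_exp 1]
      exact Real.log_le_log (Real.exp_pos 1) (by linarith [Real.exp_one_lt_d9.le])
    positivity
  have hQ : Real.log (QUpper κ B.2.2.1 s) ≤ -s * Real.log s - s * Real.log (Real.log s) +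
      s * Real.log (Real.exp 1 * κ) + |C| * (s * Real.log (Real.log (2 * s)) / Real.log s) := by
    have h1 := (abs_le.mp h65).2
    have h2 : C * (s * Real.log (Real.log (2 * s)) / Real.log s) ≤
        |C| * (s * Real.log (Real.log (2 * s)) / Real.log s) :=
      mul_le_mul_of_nonneg_right (le_abs_self C) hfrac_nonneg
    linarith
  have hfrac : s * Real.log (Real.log (2 * s)) / Real.log s ≤ s := by
    rw [div_le_iff₀ (by linarith)]
    exact mul_le_mul_of_nonneg_left hll2 hs0.le
  have hlogeκ : Real.log (Real.exp 1 * κ) = 1 + Real.log κ := by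
    rw [Real.log_mul (Real.exp_pos 1).ne' hκ0.ne', Real.log_exp]
  have hq_eq : Real.log (qUpper κ B.2.2.1 s) =
      (κ + 1) * Real.log s + Real.log (QUpper κ B.2.2.1 s) := by
    rw [QUpper_def, Real.log_mul (Real.rpow_pos_of_pos hs0 _).ne' hq.ne', Real.log_rpow hs0]; ring
  have hlogq : Real.log (qUpper κ B.2.2.1 s) ≤ -(M * s) := by
    rw [hq_eq]
    have hC' : |C| * (s * Real.log (Real.log (2 * s)) / Real.log s) ≤ |C| * s :=
      mul_le_mul_of_nonneg_left hfrac (abs_nonneg C)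
    have hlk : Real.log κ ≤ |Real.log κ| := le_abs_self _
    have hMle : -(M * s) ≥ -(|M| * s) := by nlinarith [le_abs_self M, neg_abs_le M]
    have hsl : s * M₀ ≤ s * Real.log s := mul_le_mul_of_nonneg_left hlogsM hs0.le
    have hκ1 : (κ + 1) * Real.log s ≤ (κ + 1) * s :=
      mul_le_mul_of_nonneg_left hlogs_le (by linarith)
    rw [hlogeκ] at hQ
    have hsll : 0 ≤ s * Real.log (Real.log s) := mul_nonneg hs0.le hll0
    have hslk : s * Real.log κ ≤ s * |Real.log κ| := mul_le_mul_of_nonneg_left hlk hs0.le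
    have hexp : s * M₀ = s * κ + 3 * s + s * |Real.log κ| + s * |C| + s * |M| := by rw [hM₀]; ring
    nlinarith [hQ, hC', hsl, hκ1, hsll, hslk, hexp, abs_nonneg M]
  rw [← Real.log_le_iff_le_exp hq]
  exact hlogq

/-- **From (6.3): `q⁻(s) ≤ c₂ q⁺(s)` for `s ≥ 2`**, granted Lemma 13.
[cite: IwaniecActaArith1980, Lemma 13 (6.3)] -/
theorem _root_.Literature.NumberTheory.Sieve.RosserMajorant.Iwaniec1980_lemma13.exists_qLower_le
    (h13 : RosserMajorant.Iwaniec1980_lemma13) {κ : ℝ} (hκ : 1 / 2 < κ)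
    {B : (ℝ → ℝ) × (ℝ → ℝ) × ℝ × ℝ} (hB : IsGreatestBetaSieveData κ B) :
    ∃ c₂ : ℝ, 0 ≤ c₂ ∧ ∀ s : ℝ, 2 ≤ s → qLower κ B.2.2.1 s ≤ c₂ * qUpper κ B.2.2.1 s := by
  obtain ⟨-, hpos, c₁, c₂, C, hc₁, hbounds⟩ := h13 hκ B hB
  refine ⟨max c₂ 0, le_max_right _ _, fun s hs => ?_⟩
  have hs0 : 0 < s := by linarith
  have h := (hbounds s hs).2.1
  rw [QLower_def, QUpper_def] at h
  have hpow : 0 < s ^ (-(κ + 1)) := Real.rpow_pos_of_pos hs0 _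
  have hq := (hpos s hs0).1.le
  have : s ^ (-(κ + 1)) * qLower κ B.2.2.1 s ≤ s ^ (-(κ + 1)) * (max c₂ 0 * qUpper κ B.2.2.1 s) := by
    calc s ^ (-(κ + 1)) * qLower κ B.2.2.1 s ≤ c₂ * (s ^ (-(κ + 1)) * qUpper κ B.2.2.1 s) := h
      _ ≤ max c₂ 0 * (s ^ (-(κ + 1)) * qUpper κ B.2.2.1 s) :=
          mul_le_mul_of_nonneg_right (le_max_left _ _) (mul_nonneg hpow.le hq)
      _ = _ := by ring
  exact le_of_mul_le_mul_left this hpow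

end Decay

/-! ### The majorant hypotheses (the consequences of Lemma 13 used below) -/

/-- **The consequences of Lemma 13 used for Lemmas 17–18**, isolated as a hypothesis on `(κ, β)`:
`β > 1`, positivity of `q⁺ = qUpper κ β` and `q⁻ = qLower κ β` on `(0, ∞)`, and super-exponential
decay of both (`q^±(s) ≤ e^{−Ms}` eventually, for every `M`: Iwaniec's (6.5) with (6.3)). For the
greatest data of dimension `κ > 1/2` these follow from `RosserMajorant.Iwaniec1980_lemma13`
(`RosserMajorant.Iwaniec1980_lemma13.majorantHyp`); isolating them lets a proof of this part of
Lemma 13 discharge Lemma 18 without the asymptotics (6.4)–(6.5).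
[cite: IwaniecActaArith1980, Lemma 13 (6.3), (6.5) and p. 194] -/
structure MajorantHyp (κ β : ℝ) : Prop where
  one_lt : 1 < β
  pos : ∀ s : ℝ, 0 < s → 0 < qUpper κ β s ∧ 0 < qLower κ β s
  eventually_qUpper_le : ∀ M : ℝ, ∀ᶠ s in atTop, qUpper κ β s ≤ Real.exp (-(M * s))
  eventually_qLower_le : ∀ M : ℝ, ∀ᶠ s in atTop, qLower κ β s ≤ Real.exp (-(M * s))

/-- `c e^{−c s} ≤ 1` for `c ≥ 0`, `s ≥ 1`. [folklore] -/
theorem mul_exp_neg_mul_le_one {c s : ℝ} (hc : 0 ≤ c) (hs : 1 ≤ s) :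
    c * Real.exp (-(c * s)) ≤ 1 := by
  have h1 : c * s + 1 ≤ Real.exp (c * s) := Real.add_one_le_exp (c * s)
  have h2 : c ≤ c * s := by nlinarith
  rw [Real.exp_neg, ← div_eq_mul_inv, div_le_one (Real.exp_pos _)]
  linarith

/-- **Lemma 13 supplies the majorant hypotheses** for the greatest data of dimension `κ > 1/2`.
[cite: IwaniecActaArith1980, Lemma 13] -/
theorem _root_.Literature.NumberTheory.Sieve.RosserMajorant.Iwaniec1980_lemma13.majorantHyp
    (h13 : RosserMajorant.Iwaniec1980_lemma13) {κ : ℝ} (hκ : 1 / 2 < κ)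
    {B : (ℝ → ℝ) × (ℝ → ℝ) × ℝ × ℝ} (hB : IsGreatestBetaSieveData κ B) :
    MajorantHyp κ B.2.2.1 := by
  obtain ⟨hβ1, hpos, -⟩ := h13 hκ B hB
  obtain ⟨c₂, hc₂, hqL⟩ := h13.exists_qLower_le hκ hB
  refine ⟨hβ1, hpos, fun M => h13.eventually_qUpper_le_exp hκ hB M, fun M => ?_⟩
  filter_upwards [h13.eventually_qUpper_le_exp hκ hB (M + c₂), eventually_ge_atTop (2:ℝ)]
    with s hq hs2
  have h1 : c₂ * Real.exp (-(c₂ * s)) ≤ 1 := mul_exp_neg_mul_le_one hc₂ (by linarith)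
  calc qLower κ B.2.2.1 s ≤ c₂ * qUpper κ B.2.2.1 s := hqL s hs2
    _ ≤ c₂ * Real.exp (-((M + c₂) * s)) := mul_le_mul_of_nonneg_left hq hc₂
    _ = c₂ * Real.exp (-(c₂ * s)) * Real.exp (-(M * s)) := by
        rw [show -((M + c₂) * s) = -(c₂ * s) + -(M * s) by ring, Real.exp_add]; ring
    _ ≤ 1 * Real.exp (-(M * s)) := mul_le_mul_of_nonneg_right h1 (Real.exp_pos _).le
    _ = Real.exp (-(M * s)) := one_mul _


/-! ### Assembly for the greatest `β`-sieve data (Lemma 18 from the majorant hypotheses) -/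

section Assembly

variable {κ : ℝ} (hκ : 1 / 2 < κ)
  {B : (ℝ → ℝ) × (ℝ → ℝ) × ℝ × ℝ} (hB : IsGreatestBetaSieveData κ B) (hm : MajorantHyp κ B.2.2.1)
include hκ hB hm

omit hB in
/-- The majorant bounds of Lemma 17 in the (non-strict) form used above. [folklore] -/
theorem exists_majorant_bounds :
    ∃ c : ℝ, (∀ (N : ℕ) (u : ℝ), B.2.2.1 ≤ u → contT 0 κ B.2.2.1 N u ≤ c * qLower κ B.2.2.1 u) ∧
      (∀ (N : ℕ) (u : ℝ), B.2.2.1 - 1 ≤ u → contT 1 κ B.2.2.1 N u ≤ c * qUpper κ B.2.2.1 u) := by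
  obtain ⟨c, -, hbd⟩ := exists_const_contT_lt_of_pos (by linarith) hm.one_lt hm.pos
  exact ⟨c, fun N u hu => ((hbd N).1 u hu).le, fun N u hu => ((hbd N).2 u hu).le⟩

omit hB in
/-- **`Q̃(x) = O(e^{−3x})`**: `|Q̃(x)| ≤ C e^{−3x}` eventually (from `T^± ≤ c q^±`, (6.3) and (6.5)).
[cite: IwaniecActaArith1980, Lemma 18 (`T^±(s) ≪ s^{κ+1} Q^±(s)`)] -/
theorem eventually_abs_candDiff_le :
    ∃ C : ℝ, 0 ≤ C ∧ ∀ᶠ x in atTop, |candDiff κ B.2.2.1 x| ≤ C * Real.exp (-(3 * x)) := by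
  have hβ1 := hm.one_lt
  have hpos := hm.pos
  obtain ⟨c, hbdM, hbdP⟩ := exists_majorant_bounds hκ hm
  have hc : 0 ≤ c := majorant_const_nonneg hβ1 hpos hbdP
  have hκ0 : 0 < κ := by linarith
  refine ⟨c * 2, by positivity, ?_⟩
  filter_upwards [hm.eventually_qUpper_le 3, hm.eventually_qLower_le 3,
    eventually_gt_atTop B.2.2.1, eventually_ge_atTop (2:ℝ)] with x hqU hqL hxβ hx2
  have hx0 : 0 < x := by linarith
  have hTU : contTLim 1 κ B.2.2.1 x ≤ c * qUpper κ B.2.2.1 x := contTLim_one_le hbdP (by linarith)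
  have hTL : contTLim 0 κ B.2.2.1 x ≤ c * qLower κ B.2.2.1 x := contTLim_zero_le hbdM hxβ.le
  have hTU0 : 0 ≤ contTLim 1 κ B.2.2.1 x :=
    contTLim_nonneg hκ0.le hβ1.le 1 hx0.le (fun N => hbdP N x (by linarith))
  have hTL0 : 0 ≤ contTLim 0 κ B.2.2.1 x :=
    contTLim_nonneg hκ0.le hβ1.le 0 hx0.le (fun N => hbdM N x hxβ.le)
  have hxκ : x ^ (-κ) ≤ 1 := Real.rpow_le_one_of_one_le_of_nonpos (by linarith) (by linarith)
  have hxκ0 : 0 ≤ x ^ (-κ) := Real.rpow_nonneg hx0.le _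
  have hQeq :
      candDiff κ B.2.2.1 x = x ^ (-κ) * (contTLim 1 κ B.2.2.1 x + contTLim 0 κ B.2.2.1 x) := by
    rw [candDiff, candUpper, candLower_eq_of_lt hxβ]; ring
  rw [hQeq, abs_of_nonneg (mul_nonneg hxκ0 (add_nonneg hTU0 hTL0))]
  calc x ^ (-κ) * (contTLim 1 κ B.2.2.1 x + contTLim 0 κ B.2.2.1 x)
      ≤ 1 * (c * qUpper κ B.2.2.1 x + c * qLower κ B.2.2.1 x) :=
        mul_le_mul hxκ (add_le_add hTU hTL) (add_nonneg hTU0 hTL0) zero_le_one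
    _ = c * (qUpper κ B.2.2.1 x + qLower κ B.2.2.1 x) := by ring
    _ ≤ c * (Real.exp (-(3 * x)) + Real.exp (-(3 * x))) :=
        mul_le_mul_of_nonneg_left (add_le_add hqU hqL) hc
    _ = c * 2 * Real.exp (-(3 * x)) := by ring

omit hB in
/-- **`⟨Q̃, g⟩(s) → 0`** (Iwaniec, p. 196: "`m(s) ≪ e^{−s}`, `g(s) ≪ s^{2κ−1}` … constant
`= lim = 0`").
[cite: IwaniecActaArith1980, §7 (p. 196)] -/
theorem tendsto_innerProduct_zero :
    Tendsto (sieveInnerProduct κ (candDiff κ B.2.2.1) (qFun κ)) atTop (𝓝 0) := by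
  have hκ0 : 0 < κ := by linarith
  obtain ⟨C, hC0, hQ⟩ := eventually_abs_candDiff_le hκ hm
  obtain ⟨N, hN⟩ := qFun_isBigO_rpow hκ0.le
  obtain ⟨D, hD0, hD⟩ := hN.exists_nonneg
  set N' : ℝ := max N 0 with hN'
  have hN'0 : 0 ≤ N' := le_max_right _ _
  have hg : ∀ᶠ x in atTop, |qFun κ x| ≤ D * x ^ N' := by
    filter_upwards [hD.bound, eventually_ge_atTop (1:ℝ)] with x hx hx1
    rw [Real.norm_eq_abs, Real.norm_eq_abs, abs_of_nonneg (Real.rpow_nonneg (by linarith) N)] at hx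
    exact hx.trans (mul_le_mul_of_nonneg_left
      (Real.rpow_le_rpow_of_exponent_le hx1 (le_max_left N 0)) hD0)
  obtain ⟨x₀, hx₀⟩ := eventually_atTop.mp (hQ.and hg)
  -- the bound for `R ≥ max x₀ 1 + 1`
  have hbound : ∀ᶠ R in atTop, ‖sieveInnerProduct κ (candDiff κ B.2.2.1) (qFun κ) R‖ ≤
      D * C * (R ^ (N' + 1) * Real.exp (-3 * R)) +
        κ * (D * C * Real.exp 6) * ((R + 1) ^ N' * Real.exp (-3 * (R + 1))) := by
    filter_upwards [eventually_ge_atTop (max x₀ 1 + 1)] with R hR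
    have hR1 : 1 ≤ R - 1 := by linarith [le_max_right x₀ 1]
    have hRx : x₀ ≤ R - 1 := by linarith [le_max_left x₀ 1]
    have hR0 : 0 < R := by linarith
    obtain ⟨hQR, hgR⟩ := hx₀ R (by linarith)
    -- first term
    have h1 : |R * qFun κ R * candDiff κ B.2.2.1 R| ≤ D * C * (R ^ (N' + 1) * Real.exp (-3 * R)) := by
      rw [abs_mul, abs_mul, abs_of_pos hR0]
      calc R * |qFun κ R| * |candDiff κ B.2.2.1 R| ≤ R * (D * R ^ N') * (C * Real.exp (-(3 * R))) :=
            mul_le_mul (mul_le_mul_of_nonneg_left hgR hR0.le) hQR (abs_nonneg _) (by positivity)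
        _ = D * C * (R ^ (N' + 1) * Real.exp (-3 * R)) := by
            rw [Real.rpow_add_one hR0.ne', neg_mul]; ring
    -- second term
    have h2 : |∫ x in (R - 1)..R, qFun κ (x + 1) * candDiff κ B.2.2.1 x| ≤
        D * C * Real.exp 6 * ((R + 1) ^ N' * Real.exp (-3 * (R + 1))) := by
      have hle : ∀ x ∈ Set.uIoc (R - 1) R, ‖qFun κ (x + 1) * candDiff κ B.2.2.1 x‖ ≤
          D * (R + 1) ^ N' * (C * Real.exp (-(3 * (R - 1)))) := by
        intro x hx
        rw [Set.uIoc_of_le (by linarith)] at hx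
        obtain ⟨hQx, -⟩ := hx₀ x (by linarith [hx.1])
        obtain ⟨-, hgx⟩ := hx₀ (x + 1) (by linarith [hx.1])
        rw [Real.norm_eq_abs, abs_mul]
        refine mul_le_mul (hgx.trans (mul_le_mul_of_nonneg_left (Real.rpow_le_rpow
          (by linarith [hx.1]) (by linarith [hx.2]) hN'0) hD0)) (hQx.trans
          (mul_le_mul_of_nonneg_left (Real.exp_le_exp.mpr (by linarith [hx.1])) hC0))
          (abs_nonneg _) (by positivity)
      have h := intervalIntegral.norm_integral_le_of_norm_le_const hle
      rw [Real.norm_eq_abs, show |R - (R - 1)| = 1 by rw [show R - (R - 1) = (1:ℝ) by ring]; simp,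
        mul_one] at h
      refine h.trans (le_of_eq ?_)
      rw [show (-(3 * (R - 1)) : ℝ) = -3 * (R + 1) + 6 by ring, Real.exp_add]
      ring
    -- combine
    rw [Real.norm_eq_abs]
    have hI : sieveInnerProduct κ (candDiff κ B.2.2.1) (qFun κ) R =
        R * qFun κ R * candDiff κ B.2.2.1 R -
          κ * ∫ x in (R - 1)..R, qFun κ (x + 1) * candDiff κ B.2.2.1 x := rfl
    rw [hI]
    calc |R * qFun κ R * candDiff κ B.2.2.1 R -
          κ * ∫ x in (R - 1)..R, qFun κ (x + 1) * candDiff κ B.2.2.1 x|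
        ≤ |R * qFun κ R * candDiff κ B.2.2.1 R| +
            |κ * ∫ x in (R - 1)..R, qFun κ (x + 1) * candDiff κ B.2.2.1 x| := abs_sub _ _
      _ ≤ D * C * (R ^ (N' + 1) * Real.exp (-3 * R)) +
            κ * (D * C * Real.exp 6 * ((R + 1) ^ N' * Real.exp (-3 * (R + 1)))) := by
          have h3 : |κ * ∫ x in (R - 1)..R, qFun κ (x + 1) * candDiff κ B.2.2.1 x| =
              κ * |∫ x in (R - 1)..R, qFun κ (x + 1) * candDiff κ B.2.2.1 x| := by
            rw [abs_mul, abs_of_pos hκ0]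
          rw [h3]
          exact add_le_add h1 (mul_le_mul_of_nonneg_left h2 hκ0.le)
      _ = _ := by ring
  refine squeeze_zero_norm' hbound ?_
  have t1 := tendsto_rpow_mul_exp_neg_mul_atTop_nhds_zero (N' + 1) 3 (by norm_num)
  have t2 := (tendsto_rpow_mul_exp_neg_mul_atTop_nhds_zero N' 3 (by norm_num)).comp
    (tendsto_atTop_add_const_right atTop (1:ℝ) tendsto_id)
  have := (t1.const_mul (D * C)).add (t2.const_mul (κ * (D * C * Real.exp 6)))
  simpa using this

/-- **`g(β − 1) = 0`** for the greatest data (the necessary condition of `SieveAdjoint`, Greaves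
(4.2.4.7)). [cite: IwaniecActaArith1980, §5 (p. 188) and §7 (p. 196)] -/
theorem qFun_beta_sub_one : qFun κ (B.2.2.1 - 1) = 0 := by
  have hβ1 := hm.one_lt
  exact hB.1.qFun_beta_sub_one_eq_zero (by linarith) hβ1

/-- **`g(β) ≠ 0`** for the greatest data: otherwise `β + 1` would be admissible
(`exists_isBetaSieveSolution_of_qFun_eq_zero`), contradicting maximality. [folklore] -/
theorem qFun_beta_ne_zero : qFun κ B.2.2.1 ≠ 0 := by
  have hβ1 := hm.one_lt
  intro h0
  obtain ⟨F', f', A', h'⟩ := exists_isBetaSieveSolution_of_qFun_eq_zero hκ (by linarith) h0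
  have := hB.2 F' f' _ A' h'
  linarith

/-- **`B̃ = 0` for the greatest data** (Iwaniec, p. 196). [cite: IwaniecActaArith1980, §7 (p. 196)] -/
theorem candB_eq_zero_of_greatest : candB κ B.2.2.1 = 0 := by
  obtain ⟨hβ1, hpos⟩ := And.intro hm.one_lt hm.pos
  obtain ⟨c, hbdM, hbdP⟩ := exists_majorant_bounds hκ hm
  exact candB_eq_zero (by linarith) hβ1 hpos hbdM hbdP (tendsto_innerProduct_zero hκ hm)
    (qFun_beta_sub_one hκ hB hm) (qFun_beta_ne_zero hκ hB hm)

end Assembly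

section Assembly2

variable {κ : ℝ} (hκ : 1 / 2 < κ)
  {B : (ℝ → ℝ) × (ℝ → ℝ) × ℝ × ℝ} (hB : IsGreatestBetaSieveData κ B) (hm : MajorantHyp κ B.2.2.1)
include hκ hB hm

omit hB in
/-- **Normalisation of `F̃`**: `F̃(s) − 1 = s^{−κ} T⁺(s) = O(e^{−s})` (`T⁺ ≤ c q⁺` and (6.5)).
[cite: IwaniecActaArith1980, Lemma 18 and (6.5)] -/
theorem candUpper_isBigO :
    (fun s : ℝ => candUpper κ B.2.2.1 s - 1) =O[atTop] fun s : ℝ => Real.exp (-s) := by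
  obtain ⟨hβ1, hpos⟩ := And.intro hm.one_lt hm.pos
  obtain ⟨c, hbdM, hbdP⟩ := exists_majorant_bounds hκ hm
  have hc : 0 ≤ c := majorant_const_nonneg hβ1 hpos hbdP
  have hκ0 : 0 < κ := by linarith
  refine IsBigO.of_bound c ?_
  filter_upwards [hm.eventually_qUpper_le 1, eventually_ge_atTop B.2.2.1,
    eventually_ge_atTop (1:ℝ)] with s hq hsβ hs1
  have hs0 : 0 < s := by linarith
  have hT0 : 0 ≤ contTLim 1 κ B.2.2.1 s :=
    contTLim_nonneg hκ0.le hβ1.le 1 hs0.le (fun N => hbdP N s (by linarith))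
  have hT : contTLim 1 κ B.2.2.1 s ≤ c * qUpper κ B.2.2.1 s := contTLim_one_le hbdP (by linarith)
  have hsk : s ^ (-κ) ≤ 1 := Real.rpow_le_one_of_one_le_of_nonpos hs1 (by linarith)
  have hsk0 : 0 ≤ s ^ (-κ) := Real.rpow_nonneg hs0.le _
  rw [candUpper, add_sub_cancel_left, Real.norm_eq_abs, Real.norm_eq_abs,
    abs_of_nonneg (Real.exp_pos _).le, abs_of_nonneg (mul_nonneg hsk0 hT0), one_mul] at *
  calc s ^ (-κ) * contTLim 1 κ B.2.2.1 s ≤ 1 * (c * qUpper κ B.2.2.1 s) :=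
        mul_le_mul hsk hT hT0 zero_le_one
    _ ≤ c * Real.exp (-s) := by
        rw [one_mul]; simpa using mul_le_mul_of_nonneg_left hq hc

omit hB in
/-- **Normalisation of `f̃`**: `f̃(s) − 1 = −s^{−κ} T⁻(s) = O(e^{−s})` (`T⁻ ≤ c q⁻ ≤ c c₂ q⁺` and
(6.5)). [cite: IwaniecActaArith1980, Lemma 18 and (6.3), (6.5)] -/
theorem candLower_isBigO :
    (fun s : ℝ => candLower κ B.2.2.1 s - 1) =O[atTop] fun s : ℝ => Real.exp (-s) := by
  have hβ1 := hm.one_lt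
  have hpos := hm.pos
  obtain ⟨c, hbdM, hbdP⟩ := exists_majorant_bounds hκ hm
  have hc : 0 ≤ c := majorant_const_nonneg hβ1 hpos hbdP
  have hκ0 : 0 < κ := by linarith
  refine IsBigO.of_bound c ?_
  filter_upwards [hm.eventually_qLower_le 1, eventually_gt_atTop B.2.2.1,
    eventually_ge_atTop (2:ℝ)] with s hq hsβ hs2
  have hs0 : 0 < s := by linarith
  have hT0 : 0 ≤ contTLim 0 κ B.2.2.1 s :=
    contTLim_nonneg hκ0.le hβ1.le 0 hs0.le (fun N => hbdM N s hsβ.le)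
  have hT : contTLim 0 κ B.2.2.1 s ≤ c * qLower κ B.2.2.1 s := contTLim_zero_le hbdM hsβ.le
  have hsk : s ^ (-κ) ≤ 1 := Real.rpow_le_one_of_one_le_of_nonpos (by linarith) (by linarith)
  have hsk0 : 0 ≤ s ^ (-κ) := Real.rpow_nonneg hs0.le _
  rw [candLower_eq_of_lt hsβ, Real.norm_eq_abs, Real.norm_eq_abs, abs_of_nonneg (Real.exp_pos _).le,
    show (1 : ℝ) - s ^ (-κ) * contTLim 0 κ B.2.2.1 s - 1 = -(s ^ (-κ) * contTLim 0 κ B.2.2.1 s) by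
      ring,
    abs_neg, abs_of_nonneg (mul_nonneg hsk0 hT0)]
  calc s ^ (-κ) * contTLim 0 κ B.2.2.1 s ≤ 1 * (c * qLower κ B.2.2.1 s) :=
        mul_le_mul hsk hT hT0 zero_le_one
    _ ≤ c * Real.exp (-s) := by
        rw [one_mul]; simpa using mul_le_mul_of_nonneg_left hq hc


/-- **The candidates solve the `β`-sieve system** with Iwaniec's parameter `β = B.2.2.1` and
`A = Ã`: `IsBetaSieveSolution κ F̃ f̃ β Ã` (all clauses of (1.8)–(1.9) with `B = 0`, and the
normalisation). [cite: IwaniecActaArith1980, Lemma 18 and p. 202] -/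
theorem isBetaSieveSolution_cand :
    IsBetaSieveSolution κ (candUpper κ B.2.2.1) (candLower κ B.2.2.1) B.2.2.1
      (candConst κ B.2.2.1) := by
  obtain ⟨hβ1, hpos⟩ := And.intro hm.one_lt hm.pos
  obtain ⟨c, hbdM, hbdP⟩ := exists_majorant_bounds hκ hm
  have hκ0 : 0 < κ := by linarith
  have hB0 := candB_eq_zero_of_greatest hκ hB hm
  exact
    { one_le := hβ1.le
      pos := candConst_pos hκ0 hβ1 hbdP
      upper_eq := fun s hs => candUpper_eq hκ0 hβ1 hbdP hs.1 hs.2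
      lower_eq := fun s hs => by rw [candLower_eq_of_le hs.2, hB0, zero_mul]
      hasDerivAt_upper := fun s hs => hasDerivAt_candUpper hκ0 hβ1 hpos hbdM hbdP hs
      hasDerivAt_lower := fun s hs => hasDerivAt_candLower hκ0 hβ1 hpos hbdM hbdP hs
      continuousOn_upper := continuousOn_candUpper hκ0 hβ1 hpos hbdM hbdP
      continuousOn_lower := continuousOn_candLower hκ0 hβ1 hpos hbdM hbdP
      upper_isBigO := candUpper_isBigO hκ hm
      lower_isBigO := candLower_isBigO hκ hm }

/-- **Identification** (uniqueness of the data with given `β`,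
`IsBetaSieveSolution.unique_of_beta_eq`):
`F = F̃ = 1 + s^{−κ} T⁺` and `f = f̃ = 1 − s^{−κ} T⁻` on `(0, ∞)`, `A = Ã` (Iwaniec, p. 202).
[cite: IwaniecActaArith1980, §9 (p. 202)] -/
theorem eqOn_cand :
    B.2.2.2 = candConst κ B.2.2.1 ∧ EqOn B.1 (candUpper κ B.2.2.1) (Ioi 0) ∧
      EqOn B.2.1 (candLower κ B.2.2.1) (Ioi 0) :=
  hB.1.unique_of_beta_eq (isBetaSieveSolution_cand hκ hB hm)

/-- **Lemma 18 (as used in (8.1) ⇒ (1.6)–(1.7)) for `κ > 1/2`, from the majorant hypotheses**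
(`MajorantHyp`, i.e. the part of Lemma 13 used: `β > 1`, `q^± > 0`, decay): for the greatest
`β`-sieve data `(F, f, β, A)`, every `N` and `s`,
`T⁺_N(s) ≤ s^κ (F(s) − 1)` for `s ≥ β + 1` and `T⁻_N(s) ≤ s^κ (1 − f(s))` for `s ≥ β`.
This is the statement `Iwaniec1980_lemma18` of `RosserSieveSums.lean` restricted to `κ > 1/2`
(the boundary case `κ = 1/2`, `β = 1` is not covered by the present method, whose regularity
lemmas use `β > 1`). [cite: IwaniecActaArith1980, Lemma 18] -/
theorem lemma18_of_majorantHyp (N : ℕ) (s : ℝ) :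
    (B.2.2.1 + 1 ≤ s → contT 1 κ B.2.2.1 N s ≤ s ^ κ * (B.1 s - 1)) ∧
      (B.2.2.1 ≤ s → contT 0 κ B.2.2.1 N s ≤ s ^ κ * (1 - B.2.1 s)) := by
  obtain ⟨hβ1, hpos⟩ := And.intro hm.one_lt hm.pos
  obtain ⟨c, hbdM, hbdP⟩ := exists_majorant_bounds hκ hm
  have hκ0 : 0 < κ := by linarith
  obtain ⟨-, hF, hf⟩ := eqOn_cand hκ hB hm
  have hB0 := candB_eq_zero_of_greatest hκ hB hm
  constructor
  · intro hs
    have hs0 : 0 < s := by linarith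
    rw [hF hs0, candUpper, add_sub_cancel_left, ← mul_assoc, ← Real.rpow_add hs0, add_neg_cancel,
      Real.rpow_zero, one_mul]
    exact contT_le_contTLim 1 (fun N => hbdP N s (by linarith)) N
  · intro hs
    have hs0 : 0 < s := by linarith
    rw [hf hs0]
    rcases eq_or_lt_of_le hs with h | h
    · -- `s = β`: `f̃(β) = 0` and `T⁻(β) = β^κ`
      subst h
      rw [candLower_eq_of_le le_rfl, hB0, zero_mul, sub_zero, mul_one]
      have hT : contTLim 0 κ B.2.2.1 B.2.2.1 = B.2.2.1 ^ κ := by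
        have := hB0; rw [candB] at this; linarith
      rw [← hT]
      exact contT_le_contTLim 0 (fun N => hbdM N _ le_rfl) N
    · rw [candLower_eq_of_lt h, sub_sub_cancel, ← mul_assoc, ← Real.rpow_add hs0, add_neg_cancel,
        Real.rpow_zero, one_mul]
      exact contT_le_contTLim 0 (fun N => hbdM N s hs) N

end Assembly2

/-! ### Lemma 18 from Lemma 13, and the main-term theorem from Lemmas 13 and 20 -/

/-- **The boundary case `κ = 1/2` of Lemma 18** (then `β_{1/2} = 1`, `iwaniecSiftingLimit_half_holds`,
and the kernel `(t − 1)^{−κ}` is singular at the sieving threshold; not covered by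
`lemma18_of_majorantHyp`): for the greatest data of dimension `1/2`,
`T⁺_N(s) ≤ s^{1/2} (F(s) − 1)` (`s ≥ β + 1`) and `T⁻_N(s) ≤ s^{1/2} (1 − f(s))` (`s ≥ β`).
[cite: IwaniecActaArith1980, Lemma 18] -/
def Iwaniec1980_lemma18_half : Prop :=
  ∀ (B : (ℝ → ℝ) × (ℝ → ℝ) × ℝ × ℝ) (_hB : IsGreatestBetaSieveData (1 / 2) B) (N : ℕ) (s : ℝ),
    (B.2.2.1 + 1 ≤ s → contT 1 (1 / 2) B.2.2.1 N s ≤ s ^ (1 / 2 : ℝ) * (B.1 s - 1)) ∧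
      (B.2.2.1 ≤ s → contT 0 (1 / 2) B.2.2.1 N s ≤ s ^ (1 / 2 : ℝ) * (1 - B.2.1 s))

/-- **Lemma 18 (`Iwaniec1980_lemma18` of `RosserSieveSums.lean`) from Lemma 13** and its residual
case `κ = 1/2`. [cite: IwaniecActaArith1980, Lemma 18] -/
theorem Iwaniec1980_lemma18_of_lemma13 (h13 : RosserMajorant.Iwaniec1980_lemma13)
    (hhalf : Iwaniec1980_lemma18_half) : Iwaniec1980_lemma18 := by
  intro κ hκ B hB N s
  rcases eq_or_lt_of_le hκ with h | h
  · subst h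
    exact hhalf B hB N s
  · exact lemma18_of_majorantHyp h hB (h13.majorantHyp h hB) N s

/-- **Iwaniec's main-term lower bound from Lemmas 13, 20 (and Lemma 18 at `κ = 1/2`)**, with the
existence of the greatest data now a theorem (`exists_isGreatestBetaSieveData_holds` of
`SieveFunctionsProofs.lean`). [cite: IwaniecActaArith1980, Thm 1 with (1.6)] -/
theorem Iwaniec1980_mainTerm_lower_of_lemma13 (h13 : RosserMajorant.Iwaniec1980_lemma13)
    (hhalf : Iwaniec1980_lemma18_half) (h20 : Iwaniec1980_lemma20) : Iwaniec1980_mainTerm_lower :=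
  Iwaniec1980_mainTerm_lower_of exists_isGreatestBetaSieveData_holds
    (Iwaniec1980_lemma18_of_lemma13 h13 hhalf) h20

/-- **Iwaniec's main-term upper bound from Lemmas 13, 20 (and Lemma 18 at `κ = 1/2`).**
[cite: IwaniecActaArith1980, Thm 1 with (1.7)] -/
theorem Iwaniec1980_mainTerm_upper_of_lemma13 (h13 : RosserMajorant.Iwaniec1980_lemma13)
    (hhalf : Iwaniec1980_lemma18_half) (h20 : Iwaniec1980_lemma20) : Iwaniec1980_mainTerm_upper :=
  Iwaniec1980_mainTerm_upper_of exists_isGreatestBetaSieveData_holds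
    (Iwaniec1980_lemma18_of_lemma13 h13 hhalf) h20

end BetaSieve

/-- **Iwaniec's Theorem 1, lower bound, for a sieve sequence — from Lemmas 13, 20 (and Lemma 18 at
`κ = 1/2`)**: the corrected form `SieveSequence.Iwaniec1980_lower` of the misstated
`SieveSequence.jurkat_richert_lower`. [cite: IwaniecActaArith1980, Thm 1 with (1.6)] -/
theorem SieveSequence.Iwaniec1980_lower_of_lemma13 (h13 : RosserMajorant.Iwaniec1980_lemma13)
    (hhalf : BetaSieve.Iwaniec1980_lemma18_half) (h20 : Iwaniec1980_lemma20) :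
    SieveSequence.Iwaniec1980_lower :=
  SieveSequence.Iwaniec1980_lower_of_mainTerm
    (BetaSieve.Iwaniec1980_mainTerm_lower_of_lemma13 h13 hhalf h20)

/-- **Iwaniec's Theorem 1, upper bound, for a sieve sequence — from Lemmas 13, 20 (and Lemma 18 at
`κ = 1/2`).** [cite: IwaniecActaArith1980, Thm 1 with (1.7)] -/
theorem SieveSequence.Iwaniec1980_upper_of_lemma13 (h13 : RosserMajorant.Iwaniec1980_lemma13)
    (hhalf : BetaSieve.Iwaniec1980_lemma18_half) (h20 : Iwaniec1980_lemma20) :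
    SieveSequence.Iwaniec1980_upper :=
  SieveSequence.Iwaniec1980_upper_of_mainTerm
    (BetaSieve.Iwaniec1980_mainTerm_upper_of_lemma13 h13 hhalf h20)

end Literature.NumberTheory.Sieve
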